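import Literature.Geometry.Riemannian.FlowC2AlphaNorm
import Literature.Analysis.PDE.ParabolicHolderCompactness
import HarnessLib

/-!
# Lower semicontinuity of White's `K_{2,α}` under convergence of sets (White 2005, Thm. 8.1)

Topic `Literature/Geometry/Riemannian` (companion of `FlowC2AlphaNorm.lean`, which defines
`parabolicGraph`, `HasUnitGraphBound` (`K_{2,α}(𝓜, 0) ≤ 1`) and `k2α m α 𝓜 X = K_{2,α}(𝓜; X)` of
B. White, *A local regularity theorem for mean curvature flow*, Ann. of Math. 161 (2005), §2.5;
the analytic input is the compactness of the unit parabolic `C^{2,α}` ball,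
`Literature/Analysis/PDE/ParabolicHolderCompactness.lean`).  Everything here is PROVED (no named
facts); it is a brick of the provefact unit of
`Literature/Geometry/Riemannian/WhiteLocalRegularityCylinderFlow.lean` (White's Thm. 2.6/2.7 =
Thm. 8.1 is the compactness step of the blow-up arguments of ibid. §3, §4).

Main results (namespace `Literature.Geometry.Riemannian.ParabolicFlow`):
* `isCompact_setOf_norm_map_eq`, `exists_subseq_tendsto_linearIsometry` — linear isometries
  between finite-dimensional real normed spaces form a (sequentially) compact set [folklore];
* `mem_parabolicGraph_of_tendsto` — graphs pass to the limit ("since `B` is the open ball");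
* `c2αNormOn_congr_of_isOpen` — locality of `‖·‖_{2,α;W}` on open `W`;
* `hasUnitGraphBound_of_tendsto` — `K_{2,α}(·, 0) ≤ 1` passes to lower Kuratowski limits of
  sets (the heart of White's proof of Thm. 8.1: rotations converge by compactness, the graph
  functions converge by the compactness of `{‖u‖_{2,α} ≤ 1}`);
* `k2α_le_liminf_of_liminf_pos` — White's Thm. 8.1, `K_{2,α}(𝓜, X) ≤ lim inf K_{2,α}(𝓜ᵢ, Xᵢ)`
  when `𝓜ᵢ → 𝓜` (lower half of set convergence suffices) and `Xᵢ → X`, in the case of a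
  positive limit inferior (White normalises the limit to `1` by scaling);
* `hasUnitGraphBound_of_blowDown`, `k2α_eq_zero_of_liminf_eq_zero` — the degenerate case
  `lim inf = 0`, by blowing the graphs down to a plane: scaling of the norms
  (`c2αNormOn_const_smul`), mean value bounds on `B^{m,1}`, the blow-down `r • u ∘ D_{1/r}` of a
  unit-norm function and its norm `≤ ‖W 0‖ + 14` (`c2αNormOn_blowDown_le`), dilation of graphs
  (`subset_parabolicGraph_blowDown`), sets on an affine graph (`hasUnitGraphBound_of_subset_
  affineGraph`, via an orthonormal basis of the `m`-plane `range (L + A)`), and the limit: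
  `D` of the limit is constant and `∂ₜ` vanishes, so the limit is affine;
* `k2α_le_liminf` — **White's Thm. 8.1** verbatim (for `0 < α ≤ 1`);
* `k2αOn_inter_le_liminf` — **White's Cor. 2.7**, `K_{2,α;U}(𝓜 ∩ U) ≤ lim inf K_{2,α;Uᵢ}(𝓜ᵢ)`
  (with `edistCompl_le_liminf`: `d(X, U) ≤ lim inf d(Xᵢ, Uᵢ)` from the upper half of
  `Uᵢᶜ → Uᶜ`);
* `tendsto_k2αOn_inter` — **White's Prop. 2.8** (exhaustion `U = ⋃ Uᵢ`, `Uᵢ` increasing open):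
  `K_{2,α;Uᵢ}(𝓜 ∩ Uᵢ) ↑ K_{2,α;U}(𝓜 ∩ U)` (with `iSup_edistCompl_eq`: `d(X, Uᵢ) ↑ d(X, U)` by
  compactness of closed parabolic balls);
* `k2α_eq_zero_of_subset_plane` — subsets of an `m`-plane `× ℝ` have `K_{2,α} = 0` at its points
  (the normal form of White's blow-up limits, p. 1499);
* `k2α_le_div_of_k2αOn_le`, `k2α_le_of_normalization` — the uniform bound
  `K_{2,α}(𝓜, X) ≤ s/(d(X₀, U) - ‖X - X₀‖)` of White's blow-up normalization (p. 1498), with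
  `edistCompl` `1`-Lipschitz and positive on open `U`;
* `closure_track_inter_subset` — the spacetime track `{(F s y, s) : s ∈ I}` of a jointly
  continuous family on a compact `M` over an open time set `I` is proper in its slab (White §2.3).

## References

* [White2005] B. White, *A local regularity theorem for mean curvature flow*, Ann. of Math. (2)
  161 (2005), 1487–1519, §2.5–§2.8 (Thm. 2.6, Cor. 2.7, Prop. 2.8), Thm. 8.1 (p. 1515).
-/

noncomputable section

namespace Literature.Geometry.Riemannian

open Literature.Analysis.PDE Literature.Analysis.PDE.Parabolic Metric Set Filter Topology
open scoped ENNReal NNReal InnerProductSpace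

namespace ParabolicFlow

variable {N m : ℕ}

/-! ### Topological preliminaries on parabolic spacetime -/

section Prelim

variable {E : Type*} [NormedAddCommGroup E]

/-- Convergence in parabolic spacetime is convergence of both components. [folklore] -/
theorem tendsto_parabolic_nhds_iff {ι : Type*} {l : Filter ι} {f : ι → Parabolic E}
    {Y : Parabolic E} : Tendsto f l (𝓝 Y) ↔
      Tendsto (fun i => (f i).x) l (𝓝 Y.x) ∧ Tendsto (fun i => (f i).t) l (𝓝 Y.t) := by
  rw [(homeomorphProd (E := E)).isInducing.tendsto_nhds_iff, Prod.tendsto_iff]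
  rfl

variable [NormedSpace ℝ E]

/-- Joint continuity of `(c, Z, X) ↦ D_c (Z - X)` along sequences. [folklore] -/
theorem tendsto_dilation_sub {ι : Type*} {l : Filter ι} {c : ι → ℝ} {c₀ : ℝ}
    (hc : Tendsto c l (𝓝 c₀)) {Z X : ι → Parabolic E} {Z₀ X₀ : Parabolic E}
    (hZ : Tendsto Z l (𝓝 Z₀)) (hX : Tendsto X l (𝓝 X₀)) :
    Tendsto (fun i => dilation (c i) (Z i - X i)) l (𝓝 (dilation c₀ (Z₀ - X₀))) := by
  rw [tendsto_parabolic_nhds_iff] at hZ hX ⊢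
  refine ⟨?_, ?_⟩
  · simpa using hc.smul (hZ.1.sub hX.1)
  · simpa using (hc.pow 2).mul (hZ.2.sub hX.2)

/-- A uniformly convergent sequence stays uniformly convergent along a subsequence. [folklore] -/
theorem _root_.TendstoUniformlyOn.comp_strictMono {X' G : Type*} [PseudoMetricSpace G]
    {F' : ℕ → X' → G} {f : X' → G} {s : Set X'} (h : TendstoUniformlyOn F' f atTop s)
    {φ : ℕ → ℕ} (hφ : StrictMono φ) : TendstoUniformlyOn (fun n => F' (φ n)) f atTop s := by
  rw [Metric.tendstoUniformlyOn_iff] at h ⊢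
  exact fun ε hε => hφ.tendsto_atTop.eventually (h ε hε)

end Prelim

/-! ### Compactness of the set of linear isometries -/

section Isometries

variable {E F : Type*} [NormedAddCommGroup E] [NormedSpace ℝ E] [FiniteDimensional ℝ E]
  [NormedAddCommGroup F] [NormedSpace ℝ F] [FiniteDimensional ℝ F]

/-- The linear isometries `E → F` between finite-dimensional real normed spaces form a compact
subset of `L(E, F)` (closed and bounded). [folklore] -/
theorem isCompact_setOf_norm_map_eq :
    IsCompact {T : E →L[ℝ] F | ∀ x, ‖T x‖ = ‖x‖} := by
  haveI : ProperSpace (E →L[ℝ] F) := FiniteDimensional.proper_real _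
  refine Metric.isCompact_of_isClosed_isBounded ?_ ?_
  · have : {T : E →L[ℝ] F | ∀ x, ‖T x‖ = ‖x‖} = ⋂ x, {T : E →L[ℝ] F | ‖T x‖ = ‖x‖} := by
      ext T; simp
    rw [this]
    exact isClosed_iInter fun x =>
      isClosed_eq (ContinuousLinearMap.apply ℝ F x).continuous.norm continuous_const
  · refine (Metric.isBounded_closedBall (x := (0 : E →L[ℝ] F)) (r := 1)).subset fun T hT => ?_
    rw [mem_closedBall_zero_iff]
    exact ContinuousLinearMap.opNorm_le_bound _ zero_le_one fun x => by rw [one_mul, hT x]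

/-- **Sequential compactness of linear isometries**: a sequence of linear isometries between
finite-dimensional real normed spaces has a subsequence converging (in operator norm) to a
linear isometry. [folklore] -/
theorem exists_subseq_tendsto_linearIsometry (L : ℕ → E →ₗᵢ[ℝ] F) :
    ∃ φ : ℕ → ℕ, StrictMono φ ∧ ∃ L₀ : E →ₗᵢ[ℝ] F,
      Tendsto (fun n => (L (φ n)).toContinuousLinearMap) atTop (𝓝 L₀.toContinuousLinearMap) := by
  obtain ⟨T, hT, φ, hφ, hconv⟩ := (isCompact_setOf_norm_map_eq (E := E) (F := F)).tendsto_subseq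
    (x := fun n => (L n).toContinuousLinearMap) fun n x => (L n).norm_map x
  refine ⟨φ, hφ, ⟨(T : E →ₗ[ℝ] F), hT⟩, ?_⟩
  have hTe : (⟨(T : E →ₗ[ℝ] F), hT⟩ : E →ₗᵢ[ℝ] F).toContinuousLinearMap = T := by ext; rfl
  rw [hTe]; exact hconv

end Isometries

/-! ### Graphs pass to the limit -/

section GraphLimit

/-- Pythagoras for a point of a graph over the plane `L`: `‖L ξ + w‖² = ‖ξ‖² + ‖w‖²` when
`w ⊥ range L`. [folklore] -/
theorem norm_sq_map_add_of_inner_eq_zero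
    {L : EuclideanSpace ℝ (Fin m) →ₗᵢ[ℝ] EuclideanSpace ℝ (Fin N)}
    {w : EuclideanSpace ℝ (Fin N)} (hw : ∀ η, ⟪w, L η⟫_ℝ = 0) (ξ : EuclideanSpace ℝ (Fin m)) :
    ‖L ξ + w‖ ^ 2 = ‖ξ‖ ^ 2 + ‖w‖ ^ 2 := by
  have h : ⟪L ξ, w⟫_ℝ = 0 := by rw [real_inner_comm]; exact hw ξ
  rw [norm_add_sq_real, L.norm_map, h]; ring

/-- The parameter of a graph point is no longer than the point. [folklore] -/
theorem norm_le_norm_map_add_of_inner_eq_zero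
    {L : EuclideanSpace ℝ (Fin m) →ₗᵢ[ℝ] EuclideanSpace ℝ (Fin N)} {w : EuclideanSpace ℝ (Fin N)}
    (hw : ∀ η, ⟪w, L η⟫_ℝ = 0) (ξ : EuclideanSpace ℝ (Fin m)) : ‖ξ‖ ≤ ‖L ξ + w‖ := by
  have h := norm_sq_map_add_of_inner_eq_zero hw ξ
  have h2 : ‖ξ‖ ^ 2 ≤ ‖L ξ + w‖ ^ 2 := by rw [h]; nlinarith [norm_nonneg w]
  exact (pow_le_pow_iff_left₀ (norm_nonneg _) (norm_nonneg _) two_ne_zero).1 h2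

/-- **Graphs pass to the limit.**  If `Yᵢ → Y ∈ B^{N,1}` with `Yᵢ` eventually on the parabolic
graph of `uᵢ` over the plane `Lᵢ` (`uᵢ ⊥ range Lᵢ`), `Lᵢ → L` and `uᵢ → v` uniformly on
`B^{m,1}` with `v` continuous on `B^{m,1}`, then `Y` lies on the graph of `v` over `L`
("It follows (since `B` is the open ball) that `φ̃ 𝓜 ∩ B ⊂ graph(u)`", White p. 1515).
[cite: White2005, Thm. 8.1] -/
theorem mem_parabolicGraph_of_tendsto
    {L : ℕ → EuclideanSpace ℝ (Fin m) →ₗᵢ[ℝ] EuclideanSpace ℝ (Fin N)}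
    {L₀ : EuclideanSpace ℝ (Fin m) →ₗᵢ[ℝ] EuclideanSpace ℝ (Fin N)}
    (hL : Tendsto (fun i => (L i).toContinuousLinearMap) atTop (𝓝 L₀.toContinuousLinearMap))
    {u : ℕ → Parabolic (EuclideanSpace ℝ (Fin m)) → EuclideanSpace ℝ (Fin N)}
    {v : Parabolic (EuclideanSpace ℝ (Fin m)) → EuclideanSpace ℝ (Fin N)}
    (hu : ∀ i X η, ⟪u i X, L i η⟫_ℝ = 0) (huv : TendstoUniformlyOn u v atTop (ball 0 1))
    (hvc : ContinuousOn v (ball 0 1))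
    {Y : ℕ → Parabolic (EuclideanSpace ℝ (Fin N))} {Y₀ : Parabolic (EuclideanSpace ℝ (Fin N))}
    (hY : Tendsto Y atTop (𝓝 Y₀)) (hY₀ : Y₀ ∈ ball (0 : Parabolic (EuclideanSpace ℝ (Fin N))) 1)
    (hmem : ∀ᶠ i in atTop, Y i ∈ parabolicGraph (L i) (u i) (ball 0 1)) :
    Y₀ ∈ parabolicGraph L₀ v (ball 0 1) := by
  -- pass to the subsequence along which `Y i` is on the graph, and choose parameters
  obtain ⟨φ, hφ, hφmem⟩ := extraction_of_frequently_atTop hmem.frequently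
  choose Ξ hΞB hΞ using fun n => (mem_parabolicGraph.1 (hφmem n))
  -- the parameters lie in the compact closed unit ball: extract a convergent subsequence
  obtain ⟨Ξ₀, -, ψ, hψ, hΞconv⟩ :=
    (isCompact_closedBall (0 : Parabolic (EuclideanSpace ℝ (Fin m))) 1).tendsto_subseq
      fun n => ball_subset_closedBall (hΞB n)
  have hYsub : Tendsto (fun n => Y (φ (ψ n))) atTop (𝓝 Y₀) :=
    hY.comp (hφ.comp hψ).tendsto_atTop
  have hΞx : Tendsto (fun n => (Ξ (ψ n)).x) atTop (𝓝 Ξ₀.x) :=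
    (tendsto_parabolic_nhds_iff.1 hΞconv).1
  have hΞt : Tendsto (fun n => (Ξ (ψ n)).t) atTop (𝓝 Ξ₀.t) :=
    (tendsto_parabolic_nhds_iff.1 hΞconv).2
  have hYx : Tendsto (fun n => (Y (φ (ψ n))).x) atTop (𝓝 Y₀.x) :=
    (tendsto_parabolic_nhds_iff.1 hYsub).1
  have hYt : Tendsto (fun n => (Y (φ (ψ n))).t) atTop (𝓝 Y₀.t) :=
    (tendsto_parabolic_nhds_iff.1 hYsub).2
  -- components of the graph relation
  have hx_eq : ∀ n, L (φ n) (Ξ n).x + u (φ n) (Ξ n) = (Y (φ n)).x := fun n =>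
    congrArg Parabolic.x (hΞ n)
  have ht_eq : ∀ n, (Ξ n).t = (Y (φ n)).t := fun n => congrArg Parabolic.t (hΞ n)
  -- the limit parameter lies in the OPEN unit ball
  have hΞ₀ : Ξ₀ ∈ ball (0 : Parabolic (EuclideanSpace ℝ (Fin m))) 1 := by
    rw [mem_ball_zero_one_iff]
    have hY₀' := (mem_ball_zero_one_iff _).1 hY₀
    constructor
    · have h1 : ‖Ξ₀.x‖ ≤ ‖Y₀.x‖ := by
        refine le_of_tendsto_of_tendsto' hΞx.norm hYx.norm fun n => ?_
        rw [← hx_eq]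
        exact norm_le_norm_map_add_of_inner_eq_zero (hu _ _) _
      exact h1.trans_lt hY₀'.1
    · have h2 : Ξ₀.t = Y₀.t :=
        tendsto_nhds_unique hΞt (by simpa only [ht_eq] using hYt)
      rw [h2]; exact hY₀'.2
  -- the spatial relation passes to the limit
  have hlim1 : Tendsto (fun n => L (φ (ψ n)) (Ξ (ψ n)).x) atTop (𝓝 (L₀ Ξ₀.x)) := by
    have hL' := hL.comp (hφ.comp hψ).tendsto_atTop
    have := ((isBoundedBilinearMap_apply (𝕜 := ℝ) (E := EuclideanSpace ℝ (Fin m))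
      (F := EuclideanSpace ℝ (Fin N))).continuous.tendsto (L₀.toContinuousLinearMap, Ξ₀.x)).comp
      (hL'.prodMk_nhds hΞx)
    exact this
  have hlim2 : Tendsto (fun n => u (φ (ψ n)) (Ξ (ψ n))) atTop (𝓝 (v Ξ₀)) := by
    refine (huv.comp_strictMono (hφ.comp hψ)).tendsto_comp (hvc.continuousWithinAt hΞ₀) ?_
    exact tendsto_nhdsWithin_iff.2 ⟨hΞconv, Eventually.of_forall fun n => hΞB _⟩
  have hxlim : L₀ Ξ₀.x + v Ξ₀ = Y₀.x := by
    refine tendsto_nhds_unique (hlim1.add hlim2) ?_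
    simpa only [hx_eq] using hYx
  have htlim : Ξ₀.t = Y₀.t := tendsto_nhds_unique hΞt (by simpa only [ht_eq] using hYt)
  refine mem_parabolicGraph.2 ⟨Ξ₀, hΞ₀, ?_⟩
  cases Y₀
  simp only at hxlim htlim
  rw [hxlim, htlim]

end GraphLimit

/-! ### Locality of the parabolic `C^{2,α}` norm on open sets -/

section Congr

variable {E F : Type*} [NormedAddCommGroup E] [NormedSpace ℝ E] [NormedAddCommGroup F]
  [NormedSpace ℝ F]

/-- On an open set, the spatial derivative only depends on the values on the set. [folklore] -/
theorem spaceDeriv_congr_of_isOpen {v v' : Parabolic E → F} {W : Set (Parabolic E)}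
    (hW : IsOpen W) (h : EqOn v v' W) {X : Parabolic E} (hX : X ∈ W) :
    spaceDeriv v X = spaceDeriv v' X := by
  rw [spaceDeriv_apply, spaceDeriv_apply]
  refine Filter.EventuallyEq.fderiv_eq ?_
  have hc : Continuous fun x : E => (⟨x, X.t⟩ : Parabolic E) :=
    (homeomorphProd (E := E)).symm.continuous.comp (continuous_id.prodMk continuous_const)
  filter_upwards [(hW.preimage hc).mem_nhds (by simpa using hX)] with x hx using h hx

omit [NormedSpace ℝ E] in
/-- On an open set, the time derivative only depends on the values on the set. [folklore] -/
theorem timeDeriv_congr_of_isOpen {v v' : Parabolic E → F} {W : Set (Parabolic E)}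
    (hW : IsOpen W) (h : EqOn v v' W) {X : Parabolic E} (hX : X ∈ W) :
    timeDeriv v X = timeDeriv v' X := by
  rw [timeDeriv_apply, timeDeriv_apply]
  refine Filter.EventuallyEq.deriv_eq ?_
  have hc : Continuous fun t : ℝ => (⟨X.x, t⟩ : Parabolic E) :=
    (homeomorphProd (E := E)).symm.continuous.comp (continuous_const.prodMk continuous_id)
  filter_upwards [(hW.preimage hc).mem_nhds (by simpa using hX)] with t ht using h ht

/-- On an open set, the regularity guard only depends on the values on the set. [folklore] -/
theorem isC21On_congr_of_isOpen {v v' : Parabolic E → F} {W : Set (Parabolic E)}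
    (hW : IsOpen W) (h : EqOn v v' W) (hv : IsC21On v W) : IsC21On v' W := by
  refine ⟨fun X hX => ?_, fun X hX => ?_⟩
  · refine (hv.differentiableAt X hX).congr_of_eventuallyEq ?_
    have hc : Continuous fun p : E × ℝ => (⟨p.1, p.2⟩ : Parabolic E) :=
      (homeomorphProd (E := E)).symm.continuous
    filter_upwards [(hW.preimage hc).mem_nhds (by simpa using hX)] with p hp using (h hp).symm
  · refine (hv.differentiableAt_spaceDeriv X hX).congr_of_eventuallyEq ?_
    have hc : Continuous fun x : E => (⟨x, X.t⟩ : Parabolic E) :=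
      (homeomorphProd (E := E)).symm.continuous.comp (continuous_id.prodMk continuous_const)
    filter_upwards [(hW.preimage hc).mem_nhds (by simpa using hX)] with x hx
    exact (spaceDeriv_congr_of_isOpen hW h hx).symm

/-- **Locality of `‖·‖_{2,α;W}` on open `W`**: functions that agree on an open set have the same
parabolic `C^{2,α}` norm there. [folklore] -/
theorem c2αNormOn_congr_of_isOpen {α : ℝ≥0} {v v' : Parabolic E → F} {W : Set (Parabolic E)}
    (hW : IsOpen W) (h : EqOn v v' W) : c2αNormOn α v W = c2αNormOn α v' W := by
  have hD : EqOn (spaceDeriv v) (spaceDeriv v') W := fun X hX => spaceDeriv_congr_of_isOpen hW h hX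
  have hD2 : EqOn (spaceDeriv (spaceDeriv v)) (spaceDeriv (spaceDeriv v')) W := fun X hX =>
    spaceDeriv_congr_of_isOpen hW hD hX
  have hT : EqOn (timeDeriv v) (timeDeriv v') W := fun X hX => timeDeriv_congr_of_isOpen hW h hX
  by_cases hv : IsC21On v W
  · rw [c2αNormOn_eq hv, c2αNormOn_eq (isC21On_congr_of_isOpen hW h hv), holderNormOn_congr h,
      holderNormOn_congr hD, holderNormOn_congr hD2, holderNormOn_congr hT]
  · have hv' : ¬ IsC21On v' W := fun h' => hv (isC21On_congr_of_isOpen hW h.symm h')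
    rw [c2αNormOn_of_not hv, c2αNormOn_of_not hv']

end Congr

/-! ### `K_{2,α}(·, 0) ≤ 1` passes to limits of sets (White 2005, proof of Thm. 8.1) -/

section Limit

/-- **The unit graph bound passes to lower Kuratowski limits** (the heart of White's Thm. 8.1):
if every point of `S` is a limit of points `Yᵢ ∈ Sᵢ` (eventually), and each `Sᵢ ∩ B^{N,1}` is
contained in the parabolic graph of some `uᵢ` over some `m`-plane with `‖uᵢ‖_{2,α} ≤ 1`, then
so is `S ∩ B^{N,1}`: "By passing to a subsequence, we may assume that the `φᵢ` converge to a
rotation `φ` and that the `uᵢ` converge uniformly to a function `u : B^{m,1} → R^{N-m}` with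
`‖u‖_{2,α} ≤ 1`. It follows (since `B` is the open ball) that `φ̃ 𝓜 ∩ B ⊂ graph(u)`."
[cite: White2005, Thm. 8.1] -/
theorem hasUnitGraphBound_of_tendsto {α : ℝ≥0} (hα : 0 < α)
    {S : ℕ → Set (Parabolic (EuclideanSpace ℝ (Fin N)))}
    {S₀ : Set (Parabolic (EuclideanSpace ℝ (Fin N)))}
    (hlower : ∀ Y ∈ S₀, ∃ Ys : ℕ → Parabolic (EuclideanSpace ℝ (Fin N)),
      (∀ᶠ i in atTop, Ys i ∈ S i) ∧ Tendsto Ys atTop (𝓝 Y))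
    (hS : ∀ i, HasUnitGraphBound m α (S i)) : HasUnitGraphBound m α S₀ := by
  classical
  choose L u hu hn hsub using hS
  -- Step 1: the planes converge along a subsequence
  obtain ⟨φ₁, hφ₁, L₀, hL₀⟩ := exists_subseq_tendsto_linearIsometry L
  -- Step 2: the functions converge along a further subsequence (compactness of the unit ball)
  obtain ⟨φ₂, hφ₂, v, hv, hconv, -, -, -⟩ :=
    exists_subseq_tendstoUniformlyOn_of_c2αNormOn_le_one hα (fun n => u (φ₁ n)) fun n => hn _
  have hvc : ContinuousOn v (ball 0 1) :=
    (holderOnWith_of_holderNormOn_le_one ((holderNormOn_le_c2αNormOn α v _).trans hv)).continuousOn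
      hα
  -- the limit data
  set θ : ℕ → ℕ := φ₁ ∘ φ₂ with hθ
  have hθm : StrictMono θ := hφ₁.comp hφ₂
  let u₀ : Parabolic (EuclideanSpace ℝ (Fin m)) → EuclideanSpace ℝ (Fin N) := fun X =>
    if X ∈ ball (0 : Parabolic (EuclideanSpace ℝ (Fin m))) 1 then v X else 0
  have hu₀v : EqOn u₀ v (ball 0 1) := fun X hX => if_pos hX
  have hL₀' : Tendsto (fun n => (L (θ n)).toContinuousLinearMap) atTop
      (𝓝 L₀.toContinuousLinearMap) := hL₀.comp hφ₂.tendsto_atTop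
  refine ⟨L₀, u₀, fun X η => ?_, ?_, fun Y hY => ?_⟩
  · -- orthogonality passes to the limit
    by_cases hX : X ∈ ball (0 : Parabolic (EuclideanSpace ℝ (Fin m))) 1
    · rw [hu₀v hX]
      have h1 : Tendsto (fun n => ⟪u (θ n) X, L (θ n) η⟫_ℝ) atTop (𝓝 ⟪v X, L₀ η⟫_ℝ) := by
        refine (hconv.tendsto_at hX).inner ?_
        exact ((ContinuousLinearMap.apply ℝ (EuclideanSpace ℝ (Fin N)) η).continuous.tendsto
          L₀.toContinuousLinearMap).comp hL₀'
      have h2 : (fun n => ⟪u (θ n) X, L (θ n) η⟫_ℝ) = fun _ => 0 := funext fun n => hu _ _ _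
      rw [h2] at h1
      exact (tendsto_const_nhds_iff.1 h1).symm
    · show ⟪(if X ∈ ball (0 : Parabolic (EuclideanSpace ℝ (Fin m))) 1 then v X else 0), L₀ η⟫_ℝ = 0
      rw [if_neg hX, inner_zero_left]
  · -- the norm bound
    rw [c2αNormOn_congr_of_isOpen isOpen_ball hu₀v]; exact hv
  · -- containment of `S₀ ∩ B` in the limit graph
    obtain ⟨Ys, hYsS, hYs⟩ := hlower Y hY.1
    have hYsB : ∀ᶠ i in atTop, Ys i ∈ ball (0 : Parabolic (EuclideanSpace ℝ (Fin N))) 1 :=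
      hYs (isOpen_ball.mem_nhds hY.2)
    have hmem : ∀ᶠ i in atTop, Ys i ∈ parabolicGraph (L i) (u i) (ball 0 1) :=
      (hYsS.and hYsB).mono fun i hi => hsub i hi
    have hmemθ : ∀ᶠ n in atTop, Ys (θ n) ∈ parabolicGraph (L (θ n)) (u (θ n)) (ball 0 1) :=
      hθm.tendsto_atTop.eventually hmem
    have key := mem_parabolicGraph_of_tendsto (L := fun n => L (θ n)) (u := fun n => u (θ n))
      hL₀' (fun n X η => hu _ _ _) hconv hvc (hYs.comp hθm.tendsto_atTop) hY.2 hmemθ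
    obtain ⟨Ξ, hΞ, hΞY⟩ := mem_parabolicGraph.1 key
    exact mem_parabolicGraph.2 ⟨Ξ, hΞ, by rw [hu₀v hΞ]; exact hΞY⟩

end Limit

/-! ### White's Theorem 8.1: lower semicontinuity of `K_{2,α}` -/

section LSC

/-- **White 2005, Thm. 8.1 (lower semicontinuity of `K_{2,α}` under convergence of sets; case of
a positive limit inferior).**  "Suppose `𝓜ᵢ` are sets in `R^{N,1}` that converge to `𝓜` as
sets. Suppose that `Xᵢ ∈ 𝓜ᵢ` converge to `X ∈ 𝓜`. Then `K_{2,α}(𝓜, X) ≤ lim inf K_{2,α}(𝓜ᵢ, Xᵢ)`."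
Of the set convergence only the lower half is used (every point of `𝓜` is a limit of points
`Zᵢ ∈ 𝓜ᵢ`), and `Xᵢ ∈ 𝓜ᵢ`, `X ∈ 𝓜` are not needed.  This theorem treats `0 < lim inf`
(White: "By scaling, we may assume that `L = 1`"); the degenerate case `lim inf = 0` is
`k2α_eq_zero_of_liminf_eq_zero` below, and `k2α_le_liminf` combines the two.
[cite: White2005, Thm. 8.1] -/
theorem k2α_le_liminf_of_liminf_pos {α : ℝ≥0} (hα : 0 < α)
    {M : ℕ → Set (Parabolic (EuclideanSpace ℝ (Fin N)))}
    {M₀ : Set (Parabolic (EuclideanSpace ℝ (Fin N)))}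
    (hlower : ∀ Z ∈ M₀, ∃ Zs : ℕ → Parabolic (EuclideanSpace ℝ (Fin N)),
      (∀ᶠ i in atTop, Zs i ∈ M i) ∧ Tendsto Zs atTop (𝓝 Z))
    {X : ℕ → Parabolic (EuclideanSpace ℝ (Fin N))} {X₀ : Parabolic (EuclideanSpace ℝ (Fin N))}
    (hX : Tendsto X atTop (𝓝 X₀))
    (hpos : 0 < liminf (fun i => k2α m α (M i) (X i)) atTop) :
    k2α m α M₀ X₀ ≤ liminf (fun i => k2α m α (M i) (X i)) atTop := by
  set ℓ := liminf (fun i => k2α m α (M i) (X i)) atTop with hℓ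
  refine le_of_forall_gt_imp_ge_of_dense fun d hd => ?_
  rcases eq_or_ne d ∞ with rfl | hdtop
  · exact le_top
  -- a threshold strictly between `0` and `ℓ`
  obtain ⟨b, hb0, hbℓ⟩ := exists_between hpos
  have hbtop : b ≠ ∞ := ne_top_of_lt (hbℓ.trans hd)
  have hfreq : ∃ᶠ i in atTop, b < k2α m α (M i) (X i) ∧ k2α m α (M i) (X i) < d :=
    (frequently_lt_of_liminf_lt (by isBoundedDefault) hd).and_eventually
      (eventually_lt_of_lt_liminf hbℓ) |>.mono fun i hi => ⟨hi.2, hi.1⟩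
  -- good scales in `(b, d)` for infinitely many `i`
  have hgood : ∃ᶠ i in atTop, ∃ c : ℝ, b.toReal < c ∧ c < d.toReal ∧ 0 < c ∧
      HasUnitGraphBound m α (dilation c '' ((· - X i) '' M i)) := by
    refine hfreq.mono fun i hi => ?_
    obtain ⟨hbi, hid⟩ := hi
    simp only [k2α, iInf_lt_iff] at hid
    obtain ⟨c, hc0, hcg, hcd⟩ := hid
    refine ⟨c, ?_, ?_, hc0, hcg⟩
    · have : b < ENNReal.ofReal c := hbi.trans_le (k2α_le hc0 hcg)
      exact (ENNReal.toReal_lt_toReal hbtop ENNReal.ofReal_ne_top).2 this |>.trans_eq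
        (ENNReal.toReal_ofReal hc0.le)
    · exact (ENNReal.ofReal_lt_iff_lt_toReal hc0.le hdtop).1 hcd
  obtain ⟨φ, hφ, hφP⟩ := extraction_of_frequently_atTop hgood
  choose c hcb hcd hc0 hcg using hφP
  -- the scales converge along a further subsequence, to a positive limit
  obtain ⟨c₀, hc₀mem, ψ, hψ, hcconv⟩ :=
    (isCompact_Icc (a := b.toReal) (b := d.toReal)).tendsto_subseq (x := c)
      fun n => ⟨(hcb n).le, (hcd n).le⟩
  have hb0' : 0 < b.toReal := ENNReal.toReal_pos hb0.ne' hbtop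
  have hc₀pos : 0 < c₀ := hb0'.trans_le hc₀mem.1
  -- the dilated, translated sets converge (lower half) to the dilated, translated limit
  have hS := hasUnitGraphBound_of_tendsto (m := m) hα
    (S := fun n => dilation (c (ψ n)) '' ((· - X (φ (ψ n))) '' M (φ (ψ n))))
    (S₀ := dilation c₀ '' ((· - X₀) '' M₀)) ?_ fun n => hcg _
  · calc k2α m α M₀ X₀ ≤ ENNReal.ofReal c₀ := k2α_le hc₀pos hS
      _ ≤ ENNReal.ofReal d.toReal := ENNReal.ofReal_le_ofReal hc₀mem.2
      _ = d := ENNReal.ofReal_toReal hdtop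
  · rintro Y ⟨W, ⟨Z, hZ, rfl⟩, rfl⟩
    obtain ⟨Zs, hZsM, hZs⟩ := hlower Z hZ
    refine ⟨fun n => dilation (c (ψ n)) (Zs (φ (ψ n)) - X (φ (ψ n))), ?_, ?_⟩
    · have h1 : ∀ᶠ n in atTop, Zs (φ (ψ n)) ∈ M (φ (ψ n)) :=
        (hφ.comp hψ).tendsto_atTop.eventually hZsM
      exact h1.mono fun n hn => ⟨_, ⟨_, hn, rfl⟩, rfl⟩
    · exact tendsto_dilation_sub hcconv (hZs.comp (hφ.comp hψ).tendsto_atTop)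
        (hX.comp (hφ.comp hψ).tendsto_atTop)

end LSC

open Literature.Analysis.FunctionSpaces

/-! ### Scaling of the parabolic norms by constants -/

section Scaling

variable {E F : Type*} [NormedAddCommGroup E] [NormedSpace ℝ E] [NormedAddCommGroup F]
  [NormedSpace ℝ F]

/-- `‖c • f‖_sup = |c| ‖f‖_sup`. [folklore] -/
theorem eSupNorm_const_smul {X' : Type*} (c : ℝ) (f : X' → F) :
    eSupNorm (c • f) = ‖c‖ₑ * eSupNorm f := by
  simp only [eSupNorm, Pi.smul_apply, enorm_smul, ENNReal.mul_iSup]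

/-- `‖c • f‖_{0,α;W} = |c| ‖f‖_{0,α;W}`. [folklore] -/
theorem holderNormOn_const_smul {E' : Type*} [MetricSpace E'] (α : ℝ≥0) (c : ℝ)
    (f : Parabolic E' → F) (W : Set (Parabolic E')) :
    holderNormOn α (c • f) W = ‖c‖ₑ * holderNormOn α f W := by
  have h : W.restrict (c • f) = c • W.restrict f := rfl
  rw [holderNormOn_eq, holderNormOn_eq, h, eSupNorm_const_smul, eHolderNorm_smul, mul_add]
  rfl

/-- `D (c • u) = c • D u` (no differentiability needed over a field). [folklore] -/
theorem spaceDeriv_const_smul (c : ℝ) (u : Parabolic E → F) :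
    spaceDeriv (c • u) = c • spaceDeriv u := by
  funext X
  show fderiv ℝ (fun x => c • u ⟨x, X.t⟩) X.x = c • fderiv ℝ (fun x => u ⟨x, X.t⟩) X.x
  rw [show (fun x => c • u ⟨x, X.t⟩) = c • (fun x => u ⟨x, X.t⟩) from rfl, fderiv_const_smul_field]
  rfl

omit [NormedAddCommGroup E] [NormedSpace ℝ E] in
/-- `∂ₜ (c • u) = c • ∂ₜ u` (no differentiability needed over a field). [folklore] -/
theorem timeDeriv_const_smul (c : ℝ) (u : Parabolic E → F) :
    timeDeriv (c • u) = c • timeDeriv u := by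
  funext X
  show fderiv ℝ (fun t => c • u ⟨X.x, t⟩) X.t 1 = c • fderiv ℝ (fun t => u ⟨X.x, t⟩) X.t 1
  rw [show (fun t => c • u ⟨X.x, t⟩) = c • (fun t => u ⟨X.x, t⟩) from rfl, fderiv_const_smul_field]
  rfl

/-- The regularity guard is stable under constant multiples. [folklore] -/
theorem isC21On_const_smul {u : Parabolic E → F} {W : Set (Parabolic E)} (h : IsC21On u W)
    (c : ℝ) : IsC21On (c • u) W := by
  refine ⟨fun X hX => (h.differentiableAt X hX).const_smul c, fun X hX => ?_⟩
  rw [spaceDeriv_const_smul]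
  exact (h.differentiableAt_spaceDeriv X hX).const_smul c

/-- `‖c • u‖_{2,α;W} = |c| ‖u‖_{2,α;W}` under the guard. [folklore] -/
theorem c2αNormOn_const_smul {α : ℝ≥0} {u : Parabolic E → F} {W : Set (Parabolic E)}
    (h : IsC21On u W) (c : ℝ) : c2αNormOn α (c • u) W = ‖c‖ₑ * c2αNormOn α u W := by
  rw [c2αNormOn_eq h, c2αNormOn_eq (isC21On_const_smul h c), spaceDeriv_const_smul,
    spaceDeriv_const_smul,
    timeDeriv_const_smul, holderNormOn_const_smul, holderNormOn_const_smul, holderNormOn_const_smul,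
    holderNormOn_const_smul]
  ring

/-- A parabolic `C^{0,α}` bound from a pointwise bound and a Hölder modulus. [folklore] -/
theorem holderNormOn_le_of_bounds {E' G : Type*} [PseudoMetricSpace E'] [NormedAddCommGroup G]
    {α : ℝ≥0} {f : Parabolic E' → G} {W : Set (Parabolic E')} {C₁ C₂ : ℝ≥0}
    (h1 : ∀ X ∈ W, ‖f X‖ ≤ C₁)
    (h2 : ∀ X ∈ W, ∀ Y ∈ W, ‖f X - f Y‖ ≤ C₂ * dist X Y ^ (α : ℝ)) :
    holderNormOn α f W ≤ C₁ + C₂ := by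
  rw [holderNormOn_eq]
  refine add_le_add (iSup_le fun X => ?_) (HolderWith.eHolderNorm_le fun X Y => ?_)
  · rw [← ofReal_norm]
    exact ENNReal.ofReal_le_of_le_toReal (by simpa using h1 X X.2)
  · rw [edist_dist, edist_dist, dist_eq_norm, ← ENNReal.ofReal_coe_nnreal,
      ENNReal.ofReal_rpow_of_nonneg dist_nonneg (by positivity),
      ← ENNReal.ofReal_mul (by positivity)]
    exact ENNReal.ofReal_le_ofReal (h2 X X.2 Y Y.2)

end Scaling

/-! ### Mean value bounds on the parabolic unit ball -/

section MeanValue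

variable {E F : Type*} [NormedAddCommGroup E] [NormedSpace ℝ E] [NormedAddCommGroup F]
  [NormedSpace ℝ F]

/-- Mean value inequality along a spatial slice of `B^{m,1}`. [folklore] -/
theorem norm_sub_le_of_spaceDeriv_le {u : Parabolic E → F} (hC : IsC21On u (ball 0 1)) {K : ℝ}
    (hK : ∀ X ∈ ball (0 : Parabolic E) 1, ‖spaceDeriv u X‖ ≤ K) {t : ℝ} (ht : |t| < 1)
    {x y : E} (hx : x ∈ ball (0 : E) 1) (hy : y ∈ ball (0 : E) 1) :
    ‖u ⟨x, t⟩ - u ⟨y, t⟩‖ ≤ K * ‖x - y‖ :=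
  (convex_ball (0 : E) 1).norm_image_sub_le_of_norm_hasFDerivWithin_le (f := fun x' => u ⟨x', t⟩)
    (fun _ hx' => (hC.hasFDerivAt_space (mk_mem_ball_of_mem_ball ht hx')).hasFDerivWithinAt)
    (fun _ hx' => hK _ (mk_mem_ball_of_mem_ball ht hx')) hy hx

/-- Mean value inequality along a time slice of `B^{m,1}`. [folklore] -/
theorem norm_sub_le_of_timeDeriv_le {u : Parabolic E → F} (hC : IsC21On u (ball 0 1)) {K : ℝ}
    (hK : ∀ X ∈ ball (0 : Parabolic E) 1, ‖timeDeriv u X‖ ≤ K) {x : E} (hx : ‖x‖ < 1)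
    {s t : ℝ} (hs : s ∈ Ioo (-1 : ℝ) 1) (ht : t ∈ Ioo (-1 : ℝ) 1) :
    ‖u ⟨x, t⟩ - u ⟨x, s⟩‖ ≤ K * |t - s| := by
  have h := (convex_Ioo (-1 : ℝ) 1).norm_image_sub_le_of_norm_hasDerivWithin_le
    (f := fun t' => u ⟨x, t'⟩)
    (fun t' ht' => (hC.hasDerivAt_time (mk_mem_ball_of_mem_Ioo hx ht')).hasDerivWithinAt)
    (fun t' ht' => hK _ (mk_mem_ball_of_mem_Ioo hx ht')) hs ht
  simpa [Real.norm_eq_abs] using h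

/-- Two-step mean value inequality on `B^{m,1}`: `‖u X - u Y‖ ≤ K₁ ‖x - y‖ + K₂ |t - s|`.
[folklore] -/
theorem norm_sub_le_of_derivs_le {u : Parabolic E → F} (hC : IsC21On u (ball 0 1)) {K₁ K₂ : ℝ}
    (hK₁ : ∀ X ∈ ball (0 : Parabolic E) 1, ‖spaceDeriv u X‖ ≤ K₁)
    (hK₂ : ∀ X ∈ ball (0 : Parabolic E) 1, ‖timeDeriv u X‖ ≤ K₂)
    {X Y : Parabolic E} (hX : X ∈ ball (0 : Parabolic E) 1) (hY : Y ∈ ball (0 : Parabolic E) 1) :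
    ‖u X - u Y‖ ≤ K₁ * ‖X.x - Y.x‖ + K₂ * |X.t - Y.t| := by
  obtain ⟨hXx, hXt⟩ := (mem_ball_zero_one_iff X).1 hX
  obtain ⟨hYx, hYt⟩ := (mem_ball_zero_one_iff Y).1 hY
  have h1 : ‖u ⟨X.x, X.t⟩ - u ⟨Y.x, X.t⟩‖ ≤ K₁ * ‖X.x - Y.x‖ :=
    norm_sub_le_of_spaceDeriv_le hC hK₁ hXt (mem_ball_zero_iff.2 hXx) (mem_ball_zero_iff.2 hYx)
  have h2 : ‖u ⟨Y.x, X.t⟩ - u ⟨Y.x, Y.t⟩‖ ≤ K₂ * |X.t - Y.t| :=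
    norm_sub_le_of_timeDeriv_le hC hK₂ hYx (abs_lt.1 hYt) (abs_lt.1 hXt)
  calc ‖u X - u Y‖ = ‖(u ⟨X.x, X.t⟩ - u ⟨Y.x, X.t⟩) + (u ⟨Y.x, X.t⟩ - u ⟨Y.x, Y.t⟩)‖ := by
        rw [sub_add_sub_cancel]
    _ ≤ K₁ * ‖X.x - Y.x‖ + K₂ * |X.t - Y.t| := (norm_add_le _ _).trans (add_le_add h1 h2)

/-- **Functions with constant spatial derivative and zero time derivative on `B^{m,1}` are
affine**: `v X = v 0 + A x`. [folklore] -/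
theorem eq_add_of_spaceDeriv_eq_const {v : Parabolic E → F} (hC : IsC21On v (ball 0 1))
    {A : E →L[ℝ] F} (hA : ∀ X ∈ ball (0 : Parabolic E) 1, spaceDeriv v X = A)
    (hT : ∀ X ∈ ball (0 : Parabolic E) 1, timeDeriv v X = 0) {X : Parabolic E}
    (hX : X ∈ ball (0 : Parabolic E) 1) : v X = v 0 + A X.x := by
  obtain ⟨hXx, hXt⟩ := (mem_ball_zero_one_iff X).1 hX
  -- spatial direction: `x ↦ v (x, t) - A x` has zero derivative on the unit ball
  have h1 : ‖(v ⟨X.x, X.t⟩ - A X.x) - (v ⟨0, X.t⟩ - A 0)‖ ≤ 0 * ‖X.x - 0‖ := by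
    refine (convex_ball (0 : E) 1).norm_image_sub_le_of_norm_hasFDerivWithin_le (𝕜 := ℝ)
      (f := fun x' => v ⟨x', X.t⟩ - A x') (f' := fun _ => 0) (C := 0) (fun x' hx' => ?_)
      (fun _ _ => by simp) (mem_ball_self one_pos) (mem_ball_zero_iff.2 hXx)
    have h := (hC.hasFDerivAt_space (mk_mem_ball_of_mem_ball hXt hx')).sub A.hasFDerivAt
    rw [hA _ (mk_mem_ball_of_mem_ball hXt hx'), sub_self] at h
    exact h.hasFDerivWithinAt
  -- time direction: `t ↦ v (0, t)` has zero derivative on `(-1, 1)`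
  have h2 : ‖v ⟨0, X.t⟩ - v ⟨0, 0⟩‖ ≤ 0 * |X.t - 0| :=
    norm_sub_le_of_timeDeriv_le hC (fun Y hY => (hT Y hY).symm ▸ norm_zero.le) (by simp)
      (by simp) (abs_lt.1 hXt)
  rw [zero_mul, norm_le_zero_iff, sub_eq_zero, map_zero, sub_zero] at h1
  rw [zero_mul, norm_le_zero_iff, sub_eq_zero] at h2
  rw [sub_eq_iff_eq_add] at h1
  calc v X = v ⟨X.x, X.t⟩ := rfl
    _ = v ⟨0, X.t⟩ + A X.x := by rw [h1, add_comm]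
    _ = v 0 + A X.x := by rw [h2]; rfl

end MeanValue

/-! ### Blow-down of a function on the parabolic unit ball -/

section BlowDown

variable {E F : Type*} [NormedAddCommGroup E] [NormedSpace ℝ E] [NormedAddCommGroup F]
  [NormedSpace ℝ F]

/-- Dilations fix the origin. [folklore] -/
@[simp] theorem dilation_zero' (c : ℝ) : dilation c (0 : Parabolic E) = 0 := by
  ext <;> simp

/-- Contractions map the parabolic unit ball into itself. [folklore] -/
theorem dilation_mem_ball {c : ℝ} (hc0 : 0 ≤ c) (hc1 : c ≤ 1) {X : Parabolic E}
    (hX : X ∈ ball (0 : Parabolic E) 1) : dilation c X ∈ ball (0 : Parabolic E) 1 := by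
  rw [mem_ball] at hX ⊢
  calc dist (dilation c X) 0 = dist (dilation c X) (dilation c 0) := by rw [dilation_zero']
    _ = c * dist X 0 := dist_dilation hc0 X 0
    _ ≤ 1 * dist X 0 := by gcongr
    _ < 1 := by rwa [one_mul]

variable {u : Parabolic E → F} {r : ℝ}

/-- For `r ≥ 1`, `D_{1/r}` maps `B^{m,1}` into itself. [folklore] -/
theorem dilation_inv_mem_ball (hr : 1 ≤ r) {X : Parabolic E} (hX : X ∈ ball (0 : Parabolic E) 1) :
    dilation r⁻¹ X ∈ ball (0 : Parabolic E) 1 :=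
  dilation_mem_ball (inv_nonneg.2 (zero_le_one.trans hr)) (inv_le_one_of_one_le₀ hr) hX

/-- Spatial slices of the blow-down `r • u ∘ D_{1/r}`: derivative `D u (D_{1/r} X)`. [folklore] -/
theorem hasFDerivAt_space_blowDown (hC : IsC21On u (ball 0 1)) (hr : 1 ≤ r) {X : Parabolic E}
    (hX : X ∈ ball (0 : Parabolic E) 1) :
    HasFDerivAt (fun x => (r • (u ∘ dilation r⁻¹)) ⟨x, X.t⟩) (spaceDeriv u (dilation r⁻¹ X))
      X.x := by
  have hr0 : r ≠ 0 := (one_pos.trans_le hr).ne'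
  have hout : HasFDerivAt (fun x' => u ⟨x', r⁻¹ ^ 2 * X.t⟩) (spaceDeriv u (dilation r⁻¹ X))
      (r⁻¹ • X.x) := hC.hasFDerivAt_space (dilation_inv_mem_ball hr hX)
  have hin : HasFDerivAt (fun x : E => r⁻¹ • x) (r⁻¹ • ContinuousLinearMap.id ℝ E) X.x :=
    (hasFDerivAt_id X.x).const_smul r⁻¹
  have h := (hout.comp X.x hin).const_smul r
  refine h.congr_fderiv ?_
  ext v
  simp [smul_smul, mul_inv_cancel₀ hr0]

/-- `D (r • u ∘ D_{1/r}) X = D u (D_{1/r} X)` on `B^{m,1}`. [folklore] -/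
theorem spaceDeriv_blowDown (hC : IsC21On u (ball 0 1)) (hr : 1 ≤ r) {X : Parabolic E}
    (hX : X ∈ ball (0 : Parabolic E) 1) :
    spaceDeriv (r • (u ∘ dilation r⁻¹)) X = spaceDeriv u (dilation r⁻¹ X) :=
  (hasFDerivAt_space_blowDown hC hr hX).fderiv

/-- Time slices of the blow-down: derivative `r⁻¹ • ∂ₜ u (D_{1/r} X)`. [folklore] -/
theorem hasDerivAt_time_blowDown (hC : IsC21On u (ball 0 1)) (hr : 1 ≤ r) {X : Parabolic E}
    (hX : X ∈ ball (0 : Parabolic E) 1) :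
    HasDerivAt (fun t => (r • (u ∘ dilation r⁻¹)) ⟨X.x, t⟩) (r⁻¹ • timeDeriv u (dilation r⁻¹ X))
      X.t := by
  have hr0 : r ≠ 0 := (one_pos.trans_le hr).ne'
  have hout : HasDerivAt (fun t' => u ⟨r⁻¹ • X.x, t'⟩) (timeDeriv u (dilation r⁻¹ X))
      (r⁻¹ ^ 2 * X.t) := hC.hasDerivAt_time (dilation_inv_mem_ball hr hX)
  have hin : HasDerivAt (fun t : ℝ => r⁻¹ ^ 2 * t) (r⁻¹ ^ 2) X.t := by
    have := (hasDerivAt_id X.t).const_mul (r⁻¹ ^ 2)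
    simpa only [id, mul_one] using this
  have h := (hout.scomp X.t hin).const_smul r
  have he : r • (r⁻¹ ^ 2) • timeDeriv u (dilation r⁻¹ X) = r⁻¹ • timeDeriv u (dilation r⁻¹ X) := by
    rw [smul_smul]; congr 1; field_simp
  rw [he] at h
  exact h

/-- `∂ₜ (r • u ∘ D_{1/r}) X = r⁻¹ • ∂ₜ u (D_{1/r} X)` on `B^{m,1}`. [folklore] -/
theorem timeDeriv_blowDown (hC : IsC21On u (ball 0 1)) (hr : 1 ≤ r) {X : Parabolic E}
    (hX : X ∈ ball (0 : Parabolic E) 1) :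
    timeDeriv (r • (u ∘ dilation r⁻¹)) X = r⁻¹ • timeDeriv u (dilation r⁻¹ X) :=
  (hasDerivAt_time_blowDown hC hr hX).deriv

/-- Spatial slices of `D (r • u ∘ D_{1/r})`: derivative `r⁻¹ • D² u (D_{1/r} X)`. [folklore] -/
theorem hasFDerivAt_spaceDeriv_blowDown (hC : IsC21On u (ball 0 1)) (hr : 1 ≤ r)
    {X : Parabolic E} (hX : X ∈ ball (0 : Parabolic E) 1) :
    HasFDerivAt (fun x => spaceDeriv (r • (u ∘ dilation r⁻¹)) ⟨x, X.t⟩)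
      (r⁻¹ • spaceDeriv (spaceDeriv u) (dilation r⁻¹ X)) X.x := by
  have ht : |X.t| < 1 := ((mem_ball_zero_one_iff X).1 hX).2
  have hx : X.x ∈ ball (0 : E) 1 := mem_ball_zero_iff.2 ((mem_ball_zero_one_iff X).1 hX).1
  have hout : HasFDerivAt (fun x' => spaceDeriv u ⟨x', r⁻¹ ^ 2 * X.t⟩)
      (spaceDeriv (spaceDeriv u) (dilation r⁻¹ X)) (r⁻¹ • X.x) :=
    hC.hasFDerivAt_spaceDeriv (dilation_inv_mem_ball hr hX)
  have hin : HasFDerivAt (fun x : E => r⁻¹ • x) (r⁻¹ • ContinuousLinearMap.id ℝ E) X.x :=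
    (hasFDerivAt_id X.x).const_smul r⁻¹
  have h := hout.comp X.x hin
  have he : (spaceDeriv (spaceDeriv u) (dilation r⁻¹ X)).comp (r⁻¹ • ContinuousLinearMap.id ℝ E) =
      r⁻¹ • spaceDeriv (spaceDeriv u) (dilation r⁻¹ X) := by
    ext v w; simp
  rw [he] at h
  refine h.congr_of_eventuallyEq ?_
  filter_upwards [isOpen_ball.mem_nhds hx] with x' hx'
  exact spaceDeriv_blowDown hC hr (mk_mem_ball_of_mem_ball ht hx')

/-- `D² (r • u ∘ D_{1/r}) X = r⁻¹ • D² u (D_{1/r} X)` on `B^{m,1}`. [folklore] -/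
theorem spaceDeriv_spaceDeriv_blowDown (hC : IsC21On u (ball 0 1)) (hr : 1 ≤ r) {X : Parabolic E}
    (hX : X ∈ ball (0 : Parabolic E) 1) :
    spaceDeriv (spaceDeriv (r • (u ∘ dilation r⁻¹))) X =
      r⁻¹ • spaceDeriv (spaceDeriv u) (dilation r⁻¹ X) :=
  (hasFDerivAt_spaceDeriv_blowDown hC hr hX).fderiv

/-- The blow-down satisfies the regularity guard on `B^{m,1}`. [folklore] -/
theorem isC21On_blowDown (hC : IsC21On u (ball 0 1)) (hr : 1 ≤ r) :
    IsC21On (r • (u ∘ dilation r⁻¹)) (ball (0 : Parabolic E) 1) := by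
  refine ⟨fun X hX => ?_, fun X hX => (hasFDerivAt_spaceDeriv_blowDown hC hr hX).differentiableAt⟩
  have hin : DifferentiableAt ℝ (fun p : E × ℝ => (r⁻¹ • p.1, r⁻¹ ^ 2 * p.2)) (X.x, X.t) :=
    (differentiableAt_fst.const_smul _).prodMk (differentiableAt_snd.const_mul _)
  have hout := hC.differentiableAt _ (dilation_inv_mem_ball hr hX)
  exact (hout.comp (X.x, X.t) hin).const_smul r

end BlowDown

/-! ### Bounds for the blow-down of a unit-norm function -/

section BlowDownBounds

variable {E F : Type*} [NormedAddCommGroup E] [NormedSpace ℝ E] [NormedAddCommGroup F]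
  [NormedSpace ℝ F] {α : ℝ≥0} {u : Parabolic E → F} {r : ℝ}

/-- For `0 ≤ d ≤ 2` and `0 < a ≤ 1`: `d ≤ 2 d^a`. [folklore] -/
theorem le_two_mul_rpow {d a : ℝ} (hd0 : 0 ≤ d) (hd2 : d ≤ 2) (ha0 : 0 < a) (ha1 : a ≤ 1) :
    d ≤ 2 * d ^ a := by
  have h1 : d / 2 ≤ (d / 2) ^ a :=
    Real.self_le_rpow_of_le_one (by positivity) (by linarith) ha1
  have h2 : (d / 2) ^ a ≤ d ^ a :=
    Real.rpow_le_rpow (by positivity) (by linarith) ha0.le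
  linarith

omit [NormedSpace ℝ E] in
/-- Points of the parabolic unit ball are at parabolic distance `< 2`. [folklore] -/
theorem dist_lt_two {X Y : Parabolic E} (hX : X ∈ ball (0 : Parabolic E) 1)
    (hY : Y ∈ ball (0 : Parabolic E) 1) : dist X Y < 2 :=
  calc dist X Y ≤ dist X 0 + dist Y 0 := dist_triangle_right X Y 0
    _ < 1 + 1 := add_lt_add (mem_ball.1 hX) (mem_ball.1 hY)
    _ = 2 := by norm_num

/-- The component bounds encoded by `‖u‖_{2,α; B^{m,1}} ≤ 1`. [cite: White2005, §2.5] -/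
theorem bounds_of_c2αNormOn_le_one (hn : c2αNormOn α u (ball 0 1) ≤ 1) :
    IsC21On u (ball (0 : Parabolic E) 1) ∧
    (∀ X ∈ ball (0 : Parabolic E) 1, ‖spaceDeriv u X‖ ≤ 1) ∧
    (∀ X ∈ ball (0 : Parabolic E) 1, ∀ Y ∈ ball (0 : Parabolic E) 1,
      ‖spaceDeriv u X - spaceDeriv u Y‖ ≤ dist X Y ^ (α : ℝ)) ∧
    (∀ X ∈ ball (0 : Parabolic E) 1, ‖spaceDeriv (spaceDeriv u) X‖ ≤ 1) ∧
    (∀ X ∈ ball (0 : Parabolic E) 1, ∀ Y ∈ ball (0 : Parabolic E) 1,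
      ‖spaceDeriv (spaceDeriv u) X - spaceDeriv (spaceDeriv u) Y‖ ≤ dist X Y ^ (α : ℝ)) ∧
    (∀ X ∈ ball (0 : Parabolic E) 1, ‖timeDeriv u X‖ ≤ 1) ∧
    (∀ X ∈ ball (0 : Parabolic E) 1, ∀ Y ∈ ball (0 : Parabolic E) 1,
      ‖timeDeriv u X - timeDeriv u Y‖ ≤ dist X Y ^ (α : ℝ)) := by
  have hC : IsC21On u (ball 0 1) :=
    isC21On_of_c2αNormOn_ne_top (ne_top_of_le_ne_top ENNReal.one_ne_top hn)
  have h1 : holderNormOn α (spaceDeriv u) (ball 0 1) ≤ 1 :=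
    (holderNormOn_spaceDeriv_le_c2αNormOn α u _).trans hn
  have h2 : holderNormOn α (spaceDeriv (spaceDeriv u)) (ball 0 1) ≤ 1 :=
    (holderNormOn_spaceDeriv_spaceDeriv_le_c2αNormOn α u _).trans hn
  have h3 : holderNormOn α (timeDeriv u) (ball 0 1) ≤ 1 :=
    (holderNormOn_timeDeriv_le_c2αNormOn α u _).trans hn
  refine ⟨hC, fun X hX => ?_, fun X hX Y hY => ?_, fun X hX => ?_, fun X hX Y hY => ?_,
    fun X hX => ?_, fun X hX Y hY => ?_⟩
  · simpa using norm_le_of_holderNormOn_le h1 hX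
  · simpa using norm_sub_le_of_holderNormOn_le h1 hX hY
  · simpa using norm_le_of_holderNormOn_le h2 hX
  · simpa using norm_sub_le_of_holderNormOn_le h2 hX hY
  · simpa using norm_le_of_holderNormOn_le h3 hX
  · simpa using norm_sub_le_of_holderNormOn_le h3 hX hY

/-- `‖D (r • u ∘ D_{1/r}) X‖ ≤ 1` on `B^{m,1}`. [cite: White2005, Thm. 8.1] -/
theorem norm_spaceDeriv_blowDown_le (hn : c2αNormOn α u (ball 0 1) ≤ 1) (hr : 1 ≤ r)
    {X : Parabolic E} (hX : X ∈ ball (0 : Parabolic E) 1) :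
    ‖spaceDeriv (r • (u ∘ dilation r⁻¹)) X‖ ≤ 1 := by
  obtain ⟨hC, hD, -⟩ := bounds_of_c2αNormOn_le_one hn
  rw [spaceDeriv_blowDown hC hr hX]
  exact hD _ (dilation_inv_mem_ball hr hX)

/-- The Hölder modulus of `D (r • u ∘ D_{1/r})` on `B^{m,1}` improves by `r^{-α}`.
[cite: White2005, Thm. 8.1] -/
theorem norm_spaceDeriv_blowDown_sub_le (hn : c2αNormOn α u (ball 0 1) ≤ 1) (hr : 1 ≤ r)
    {X Y : Parabolic E} (hX : X ∈ ball (0 : Parabolic E) 1) (hY : Y ∈ ball (0 : Parabolic E) 1) :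
    ‖spaceDeriv (r • (u ∘ dilation r⁻¹)) X - spaceDeriv (r • (u ∘ dilation r⁻¹)) Y‖ ≤
      r ^ (-(α : ℝ)) * dist X Y ^ (α : ℝ) := by
  obtain ⟨hC, -, hDH, -⟩ := bounds_of_c2αNormOn_le_one hn
  have hr0 : 0 ≤ r⁻¹ := inv_nonneg.2 (zero_le_one.trans hr)
  rw [spaceDeriv_blowDown hC hr hX, spaceDeriv_blowDown hC hr hY]
  refine (hDH _ (dilation_inv_mem_ball hr hX) _ (dilation_inv_mem_ball hr hY)).trans_eq ?_
  rw [dist_dilation hr0, Real.mul_rpow hr0 dist_nonneg, Real.rpow_neg (zero_le_one.trans hr),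
    Real.inv_rpow (zero_le_one.trans hr)]

/-- `‖D² (r • u ∘ D_{1/r}) X‖ ≤ r⁻¹` on `B^{m,1}`. [cite: White2005, Thm. 8.1] -/
theorem norm_spaceDeriv_spaceDeriv_blowDown_le (hn : c2αNormOn α u (ball 0 1) ≤ 1) (hr : 1 ≤ r)
    {X : Parabolic E} (hX : X ∈ ball (0 : Parabolic E) 1) :
    ‖spaceDeriv (spaceDeriv (r • (u ∘ dilation r⁻¹))) X‖ ≤ r⁻¹ := by
  obtain ⟨hC, -, -, hD2, -⟩ := bounds_of_c2αNormOn_le_one hn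
  have hr0 : 0 ≤ r⁻¹ := inv_nonneg.2 (zero_le_one.trans hr)
  rw [spaceDeriv_spaceDeriv_blowDown hC hr hX, norm_smul, Real.norm_of_nonneg hr0]
  exact mul_le_of_le_one_right hr0 (hD2 _ (dilation_inv_mem_ball hr hX))

/-- Hölder modulus of `D² (r • u ∘ D_{1/r})` on `B^{m,1}`. [cite: White2005, Thm. 8.1] -/
theorem norm_spaceDeriv_spaceDeriv_blowDown_sub_le (hn : c2αNormOn α u (ball 0 1) ≤ 1)
    (hr : 1 ≤ r) {X Y : Parabolic E} (hX : X ∈ ball (0 : Parabolic E) 1)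
    (hY : Y ∈ ball (0 : Parabolic E) 1) :
    ‖spaceDeriv (spaceDeriv (r • (u ∘ dilation r⁻¹))) X -
        spaceDeriv (spaceDeriv (r • (u ∘ dilation r⁻¹))) Y‖ ≤ dist X Y ^ (α : ℝ) := by
  obtain ⟨hC, -, -, -, hD2H, -⟩ := bounds_of_c2αNormOn_le_one hn
  have hr0 : 0 ≤ r⁻¹ := inv_nonneg.2 (zero_le_one.trans hr)
  have hr1 : r⁻¹ ≤ 1 := inv_le_one_of_one_le₀ hr
  rw [spaceDeriv_spaceDeriv_blowDown hC hr hX, spaceDeriv_spaceDeriv_blowDown hC hr hY,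
    ← smul_sub, norm_smul, Real.norm_of_nonneg hr0]
  have h := hD2H _ (dilation_inv_mem_ball hr hX) _ (dilation_inv_mem_ball hr hY)
  rw [dist_dilation hr0] at h
  calc r⁻¹ * ‖spaceDeriv (spaceDeriv u) (dilation r⁻¹ X) -
          spaceDeriv (spaceDeriv u) (dilation r⁻¹ Y)‖
      ≤ 1 * (r⁻¹ * dist X Y) ^ (α : ℝ) := by gcongr
    _ ≤ 1 * dist X Y ^ (α : ℝ) := by
        gcongr
        exact mul_le_of_le_one_left dist_nonneg hr1
    _ = dist X Y ^ (α : ℝ) := one_mul _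

/-- `‖∂ₜ (r • u ∘ D_{1/r}) X‖ ≤ r⁻¹` on `B^{m,1}`. [cite: White2005, Thm. 8.1] -/
theorem norm_timeDeriv_blowDown_le (hn : c2αNormOn α u (ball 0 1) ≤ 1) (hr : 1 ≤ r)
    {X : Parabolic E} (hX : X ∈ ball (0 : Parabolic E) 1) :
    ‖timeDeriv (r • (u ∘ dilation r⁻¹)) X‖ ≤ r⁻¹ := by
  obtain ⟨hC, -, -, -, -, hT, -⟩ := bounds_of_c2αNormOn_le_one hn
  have hr0 : 0 ≤ r⁻¹ := inv_nonneg.2 (zero_le_one.trans hr)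
  rw [timeDeriv_blowDown hC hr hX, norm_smul, Real.norm_of_nonneg hr0]
  exact mul_le_of_le_one_right hr0 (hT _ (dilation_inv_mem_ball hr hX))

/-- Hölder modulus of `∂ₜ (r • u ∘ D_{1/r})` on `B^{m,1}`. [cite: White2005, Thm. 8.1] -/
theorem norm_timeDeriv_blowDown_sub_le (hn : c2αNormOn α u (ball 0 1) ≤ 1) (hr : 1 ≤ r)
    {X Y : Parabolic E} (hX : X ∈ ball (0 : Parabolic E) 1) (hY : Y ∈ ball (0 : Parabolic E) 1) :
    ‖timeDeriv (r • (u ∘ dilation r⁻¹)) X - timeDeriv (r • (u ∘ dilation r⁻¹)) Y‖ ≤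
      dist X Y ^ (α : ℝ) := by
  obtain ⟨hC, -, -, -, -, -, hTH⟩ := bounds_of_c2αNormOn_le_one hn
  have hr0 : 0 ≤ r⁻¹ := inv_nonneg.2 (zero_le_one.trans hr)
  have hr1 : r⁻¹ ≤ 1 := inv_le_one_of_one_le₀ hr
  rw [timeDeriv_blowDown hC hr hX, timeDeriv_blowDown hC hr hY, ← smul_sub, norm_smul,
    Real.norm_of_nonneg hr0]
  have h := hTH _ (dilation_inv_mem_ball hr hX) _ (dilation_inv_mem_ball hr hY)
  rw [dist_dilation hr0] at h
  calc r⁻¹ * ‖timeDeriv u (dilation r⁻¹ X) - timeDeriv u (dilation r⁻¹ Y)‖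
      ≤ 1 * (r⁻¹ * dist X Y) ^ (α : ℝ) := by gcongr
    _ ≤ 1 * dist X Y ^ (α : ℝ) := by
        gcongr
        exact mul_le_of_le_one_left dist_nonneg hr1
    _ = dist X Y ^ (α : ℝ) := one_mul _

/-- The two-step mean value bound for the blow-down: `‖W X - W Y‖ ≤ ‖x - y‖ + r⁻¹ |t - s|`.
[cite: White2005, Thm. 8.1] -/
theorem norm_blowDown_sub_le (hn : c2αNormOn α u (ball 0 1) ≤ 1) (hr : 1 ≤ r)
    {X Y : Parabolic E} (hX : X ∈ ball (0 : Parabolic E) 1) (hY : Y ∈ ball (0 : Parabolic E) 1) :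
    ‖(r • (u ∘ dilation r⁻¹)) X - (r • (u ∘ dilation r⁻¹)) Y‖ ≤
      ‖X.x - Y.x‖ + r⁻¹ * |X.t - Y.t| := by
  obtain ⟨hC, hD, -, -, -, hT, -⟩ := bounds_of_c2αNormOn_le_one hn
  have hr0' : 0 < r := one_pos.trans_le hr
  have hr0 : 0 ≤ r⁻¹ := inv_nonneg.2 hr0'.le
  have h := norm_sub_le_of_derivs_le hC hD hT (dilation_inv_mem_ball hr hX)
    (dilation_inv_mem_ball hr hY)
  simp only [dilation_x, dilation_t, ← smul_sub, ← mul_sub, norm_smul, abs_mul,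
    Real.norm_of_nonneg hr0, abs_of_nonneg (pow_nonneg hr0 2), one_mul] at h
  show ‖r • u (dilation r⁻¹ X) - r • u (dilation r⁻¹ Y)‖ ≤ _
  rw [← smul_sub, norm_smul, Real.norm_of_nonneg hr0'.le]
  calc r * ‖u (dilation r⁻¹ X) - u (dilation r⁻¹ Y)‖
      ≤ r * (r⁻¹ * ‖X.x - Y.x‖ + r⁻¹ ^ 2 * |X.t - Y.t|) := by gcongr
    _ = ‖X.x - Y.x‖ + r⁻¹ * |X.t - Y.t| := by field_simp

/-- Hölder modulus of the blow-down on `B^{m,1}`: `‖W X - W Y‖ ≤ 6 d(X, Y)^α` (`α ≤ 1`).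
[cite: White2005, Thm. 8.1] -/
theorem norm_blowDown_sub_le_rpow (hα : 0 < α) (hα1 : α ≤ 1) (hn : c2αNormOn α u (ball 0 1) ≤ 1)
    (hr : 1 ≤ r) {X Y : Parabolic E} (hX : X ∈ ball (0 : Parabolic E) 1)
    (hY : Y ∈ ball (0 : Parabolic E) 1) :
    ‖(r • (u ∘ dilation r⁻¹)) X - (r • (u ∘ dilation r⁻¹)) Y‖ ≤ 6 * dist X Y ^ (α : ℝ) := by
  have hd2 := (dist_lt_two hX hY).le
  have hdx := dist_x_le X Y
  have hdt := dist_t_le_sq X Y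
  rw [dist_eq_norm] at hdx
  rw [Real.dist_eq] at hdt
  have hr1 : r⁻¹ ≤ 1 := inv_le_one_of_one_le₀ hr
  have hr0 : 0 ≤ r⁻¹ := inv_nonneg.2 (zero_le_one.trans hr)
  have hmain := le_two_mul_rpow dist_nonneg hd2 (NNReal.coe_pos.2 hα) (by exact_mod_cast hα1)
  calc ‖(r • (u ∘ dilation r⁻¹)) X - (r • (u ∘ dilation r⁻¹)) Y‖
      ≤ ‖X.x - Y.x‖ + r⁻¹ * |X.t - Y.t| := norm_blowDown_sub_le hn hr hX hY
    _ ≤ dist X Y + 1 * dist X Y ^ 2 := by gcongr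
    _ ≤ dist X Y + 1 * (2 * dist X Y) := by gcongr; nlinarith [dist_nonneg (x := X) (y := Y)]
    _ = 3 * dist X Y := by ring
    _ ≤ 3 * (2 * dist X Y ^ (α : ℝ)) := by gcongr
    _ = 6 * dist X Y ^ (α : ℝ) := by ring

/-- Pointwise bound for the blow-down on `B^{m,1}`: `‖W X‖ ≤ ‖W 0‖ + 2`.
[cite: White2005, Thm. 8.1] -/
theorem norm_blowDown_le (hn : c2αNormOn α u (ball 0 1) ≤ 1) (hr : 1 ≤ r) {X : Parabolic E}
    (hX : X ∈ ball (0 : Parabolic E) 1) :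
    ‖(r • (u ∘ dilation r⁻¹)) X‖ ≤ ‖(r • (u ∘ dilation r⁻¹)) 0‖ + 2 := by
  obtain ⟨hXx, hXt⟩ := (mem_ball_zero_one_iff X).1 hX
  have hr1 : r⁻¹ ≤ 1 := inv_le_one_of_one_le₀ hr
  have hr0 : 0 ≤ r⁻¹ := inv_nonneg.2 (zero_le_one.trans hr)
  have h := norm_blowDown_sub_le hn hr hX (mem_ball_self one_pos)
  simp only [zero_x, zero_t, sub_zero] at h
  have h2 : ‖X.x‖ + r⁻¹ * |X.t| ≤ 2 := by nlinarith [abs_nonneg X.t]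
  calc ‖(r • (u ∘ dilation r⁻¹)) X‖
      ≤ ‖(r • (u ∘ dilation r⁻¹)) X - (r • (u ∘ dilation r⁻¹)) 0‖ + ‖(r • (u ∘ dilation r⁻¹)) 0‖ :=
        norm_le_norm_sub_add _ _
    _ ≤ _ := by linarith

/-- **The parabolic `C^{2,α}` norm of the blow-down**: `‖r • u ∘ D_{1/r}‖_{2,α; B^{m,1}} ≤
‖W 0‖ + 14` when `‖u‖_{2,α; B^{m,1}} ≤ 1`, `r ≥ 1`, `0 < α ≤ 1`. [cite: White2005, Thm. 8.1] -/
theorem c2αNormOn_blowDown_le (hα : 0 < α) (hα1 : α ≤ 1) (hn : c2αNormOn α u (ball 0 1) ≤ 1)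
    (hr : 1 ≤ r) :
    c2αNormOn α (r • (u ∘ dilation r⁻¹)) (ball 0 1) ≤ ‖(r • (u ∘ dilation r⁻¹)) 0‖ₑ + 14 := by
  obtain ⟨hC, -⟩ := bounds_of_c2αNormOn_le_one hn
  have hr1 : r⁻¹ ≤ 1 := inv_le_one_of_one_le₀ hr
  have hrα : r ^ (-(α : ℝ)) ≤ 1 :=
    Real.rpow_le_one_of_one_le_of_nonpos hr (neg_nonpos.2 α.2)
  have b0 : holderNormOn α (r • (u ∘ dilation r⁻¹)) (ball 0 1) ≤
      (‖(r • (u ∘ dilation r⁻¹)) 0‖₊ + 2 : ℝ≥0) + (6 : ℝ≥0) :=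
    holderNormOn_le_of_bounds (fun X hX => by simpa using norm_blowDown_le hn hr hX)
      fun X hX Y hY => by simpa using norm_blowDown_sub_le_rpow hα hα1 hn hr hX hY
  have b1 : holderNormOn α (spaceDeriv (r • (u ∘ dilation r⁻¹))) (ball 0 1) ≤
      (1 : ℝ≥0) + (1 : ℝ≥0) :=
    holderNormOn_le_of_bounds (fun X hX => by simpa using norm_spaceDeriv_blowDown_le hn hr hX)
      fun X hX Y hY => by
        have h := norm_spaceDeriv_blowDown_sub_le hn hr hX hY
        rw [NNReal.coe_one, one_mul]
        exact h.trans (mul_le_of_le_one_left (by positivity) hrα)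
  have b2 : holderNormOn α (spaceDeriv (spaceDeriv (r • (u ∘ dilation r⁻¹)))) (ball 0 1) ≤
      (1 : ℝ≥0) + (1 : ℝ≥0) :=
    holderNormOn_le_of_bounds
      (fun X hX => by simpa using (norm_spaceDeriv_spaceDeriv_blowDown_le hn hr hX).trans hr1)
      fun X hX Y hY => by simpa using norm_spaceDeriv_spaceDeriv_blowDown_sub_le hn hr hX hY
  have b3 : holderNormOn α (timeDeriv (r • (u ∘ dilation r⁻¹))) (ball 0 1) ≤
      (1 : ℝ≥0) + (1 : ℝ≥0) :=
    holderNormOn_le_of_bounds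
      (fun X hX => by simpa using (norm_timeDeriv_blowDown_le hn hr hX).trans hr1)
      fun X hX Y hY => by simpa using norm_timeDeriv_blowDown_sub_le hn hr hX hY
  rw [c2αNormOn_eq (isC21On_blowDown hC hr)]
  have hW0 : ((‖(r • (u ∘ dilation r⁻¹)) 0‖₊ + 2 : ℝ≥0) : ℝ≥0∞) =
      ‖(r • (u ∘ dilation r⁻¹)) 0‖ₑ + 2 := by
    rw [ENNReal.coe_add, ENNReal.coe_ofNat]; rfl
  calc holderNormOn α (r • (u ∘ dilation r⁻¹)) (ball 0 1) +
        holderNormOn α (spaceDeriv (r • (u ∘ dilation r⁻¹))) (ball 0 1) +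
        holderNormOn α (spaceDeriv (spaceDeriv (r • (u ∘ dilation r⁻¹)))) (ball 0 1) +
        holderNormOn α (timeDeriv (r • (u ∘ dilation r⁻¹))) (ball 0 1)
      ≤ (((‖(r • (u ∘ dilation r⁻¹)) 0‖₊ + 2 : ℝ≥0) : ℝ≥0∞) + (6 : ℝ≥0)) + ((1 : ℝ≥0) + (1 : ℝ≥0)) +
          ((1 : ℝ≥0) + (1 : ℝ≥0)) + ((1 : ℝ≥0) + (1 : ℝ≥0)) := by gcongr
    _ = ‖(r • (u ∘ dilation r⁻¹)) 0‖ₑ + 14 := by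
        rw [hW0]
        simp only [ENNReal.coe_one, ENNReal.coe_ofNat]
        ring

end BlowDownBounds

/-! ### Dilating a graph -/

section GraphDilation

/-- **Dilating a unit graph**: if `D_{1/r} S ∩ B^{N,1}` lies on the graph of `u` over `L`, then
`S ∩ B^{N,1}` lies on the graph of the blow-down `r • u ∘ D_{1/r}` over `L` (`r ≥ 1`).
[cite: White2005, Thm. 8.1] -/
theorem subset_parabolicGraph_blowDown
    {L : EuclideanSpace ℝ (Fin m) →ₗᵢ[ℝ] EuclideanSpace ℝ (Fin N)}
    {u : Parabolic (EuclideanSpace ℝ (Fin m)) → EuclideanSpace ℝ (Fin N)}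
    (hu : ∀ X η, ⟪u X, L η⟫_ℝ = 0) {r : ℝ} (hr : 1 ≤ r)
    {S : Set (Parabolic (EuclideanSpace ℝ (Fin N)))}
    (hsub : dilation r⁻¹ '' S ∩ ball 0 1 ⊆ parabolicGraph L u (ball 0 1)) :
    S ∩ ball 0 1 ⊆ parabolicGraph L (r • (u ∘ dilation r⁻¹)) (ball 0 1) := by
  have hr0' : 0 < r := one_pos.trans_le hr
  have hr0 : r ≠ 0 := hr0'.ne'
  rintro Y ⟨hYS, hYB⟩
  obtain ⟨Ξ, hΞB, hΞ⟩ := mem_parabolicGraph.1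
    (hsub ⟨mem_image_of_mem _ hYS, dilation_inv_mem_ball hr hYB⟩)
  have hx : L Ξ.x + u Ξ = r⁻¹ • Y.x := congrArg Parabolic.x hΞ
  have ht : Ξ.t = r⁻¹ ^ 2 * Y.t := congrArg Parabolic.t hΞ
  have hYx : Y.x = L (r • Ξ.x) + r • u Ξ := by
    rw [L.map_smul, ← smul_add, hx, smul_smul, mul_inv_cancel₀ hr0, one_smul]
  have hYt : Y.t = r ^ 2 * Ξ.t := by rw [ht]; field_simp
  obtain ⟨hYx1, hYt1⟩ := (mem_ball_zero_one_iff Y).1 hYB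
  refine mem_parabolicGraph.2 ⟨dilation r Ξ, ?_, ?_⟩
  · rw [mem_ball_zero_one_iff, dilation_x, dilation_t]
    constructor
    · calc ‖r • Ξ.x‖ ≤ ‖L (r • Ξ.x) + r • u Ξ‖ :=
            norm_le_norm_map_add_of_inner_eq_zero
              (fun η => by rw [real_inner_smul_left, hu, mul_zero]) _
        _ = ‖Y.x‖ := by rw [hYx]
        _ < 1 := hYx1
    · rw [← hYt]; exact hYt1
  · have h1 : (r • (u ∘ dilation r⁻¹)) (dilation r Ξ) = r • u Ξ := by
      simp only [Pi.smul_apply, Function.comp_apply, dilation_dilation, inv_mul_cancel₀ hr0,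
        dilation_one]
    rw [h1]
    cases Y
    simp only [dilation_x, dilation_t] at hYx hYt ⊢
    rw [hYx, hYt]

end GraphDilation

/-! ### Sets contained in an `m`-plane have `K_{2,α}(·, 0) ≤ 1` -/

section Affine

/-- Pythagoras: each of two orthogonal vectors is no longer than their sum. [folklore] -/
theorem norm_le_norm_add_of_inner_eq_zero {x y : EuclideanSpace ℝ (Fin N)} (h : ⟪x, y⟫_ℝ = 0) :
    ‖x‖ ≤ ‖x + y‖ ∧ ‖y‖ ≤ ‖x + y‖ := by
  have hsq : ‖x + y‖ * ‖x + y‖ = ‖x‖ * ‖x‖ + ‖y‖ * ‖y‖ :=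
    norm_add_sq_eq_norm_sq_add_norm_sq_real h
  have hx := norm_nonneg x
  have hy := norm_nonneg y
  have hxy := norm_nonneg (x + y)
  constructor
  · refine (pow_le_pow_iff_left₀ hx hxy two_ne_zero).1 ?_
    rw [sq, sq, hsq]; linarith [mul_self_nonneg ‖y‖]
  · refine (pow_le_pow_iff_left₀ hy hxy two_ne_zero).1 ?_
    rw [sq, sq, hsq]; linarith [mul_self_nonneg ‖x‖]


/-- **Sets in the unit ball lying on an affine graph `x ↦ p + A x` over `L` (with `A ⊥ L`)
have `K_{2,α}(·, 0) ≤ 1`**: they lie on the graph of a constant of norm `< 1` over the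
`m`-plane `range (L + A)`. [cite: White2005, §2.5] -/
theorem hasUnitGraphBound_of_subset_affineGraph {α : ℝ≥0}
    {S : Set (Parabolic (EuclideanSpace ℝ (Fin N)))}
    (L : EuclideanSpace ℝ (Fin m) →ₗᵢ[ℝ] EuclideanSpace ℝ (Fin N)) (p : EuclideanSpace ℝ (Fin N))
    (A : EuclideanSpace ℝ (Fin m) →L[ℝ] EuclideanSpace ℝ (Fin N)) (hA : ∀ ξ η, ⟪A ξ, L η⟫_ℝ = 0)
    (hsub : S ∩ ball 0 1 ⊆ parabolicGraph L (fun X => p + A X.x) (ball 0 1)) :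
    HasUnitGraphBound m α S := by
  classical
  -- the injective linear map `T = L + A`; its range `V` is an `m`-plane
  let T : EuclideanSpace ℝ (Fin m) →ₗ[ℝ] EuclideanSpace ℝ (Fin N) :=
    L.toLinearMap + (A : EuclideanSpace ℝ (Fin m) →ₗ[ℝ] EuclideanSpace ℝ (Fin N))
  have hT : ∀ ξ, T ξ = L ξ + A ξ := fun ξ => rfl
  have hTnorm : ∀ ξ, ‖ξ‖ ≤ ‖T ξ‖ := fun ξ => by
    rw [hT]; exact norm_le_norm_map_add_of_inner_eq_zero (fun η => hA ξ η) ξ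
  have hTinj : Function.Injective T := by
    intro ξ₁ ξ₂ h
    have h1 := hTnorm (ξ₁ - ξ₂)
    rw [map_sub, h, sub_self, norm_zero, norm_le_zero_iff, sub_eq_zero] at h1
    exact h1
  let V : Submodule ℝ (EuclideanSpace ℝ (Fin N)) := LinearMap.range T
  have hV : Module.finrank ℝ V = m := by
    rw [LinearMap.finrank_range_of_inj hTinj, finrank_euclideanSpace_fin]
  let b : OrthonormalBasis (Fin m) ℝ V := (stdOrthonormalBasis ℝ V).reindex (finCongr hV)
  let L' : EuclideanSpace ℝ (Fin m) →ₗᵢ[ℝ] EuclideanSpace ℝ (Fin N) :=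
    V.subtypeₗᵢ.comp b.repr.symm.toLinearIsometry
  have hL'apply : ∀ ζ, L' ζ = (b.repr.symm ζ : EuclideanSpace ℝ (Fin N)) := fun ζ => rfl
  have hL'mem : ∀ ζ, L' ζ ∈ V := fun ζ => (b.repr.symm ζ).2
  have hL'surj : ∀ q ∈ V, ∃ ζ, L' ζ = q := fun q hq =>
    ⟨b.repr ⟨q, hq⟩, by rw [hL'apply, LinearIsometryEquiv.symm_apply_apply]⟩
  -- the constant normal part of `p`
  let p' : EuclideanSpace ℝ (Fin N) := p - V.starProjection p
  have hp' : p' ∈ Vᗮ := Submodule.sub_starProjection_mem_orthogonal (K := V) p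
  have horth : ∀ η, ⟪p', L' η⟫_ℝ = 0 := fun η =>
    Submodule.inner_left_of_mem_orthogonal (K := V) (hL'mem η) hp'
  -- every point of `S ∩ B` decomposes as `q + p'` with `q ∈ V` and `‖q‖, ‖p'‖ ≤ ‖Y.x‖`
  have key : ∀ Y ∈ S ∩ ball (0 : Parabolic (EuclideanSpace ℝ (Fin N))) 1,
      ∃ q ∈ V, Y.x = q + p' ∧ ‖q‖ ≤ ‖Y.x‖ ∧ ‖p'‖ ≤ ‖Y.x‖ := by
    intro Y hY
    obtain ⟨Ξ, -, hΞY⟩ := mem_parabolicGraph.1 (hsub hY)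
    have hYx : Y.x = L Ξ.x + (p + A Ξ.x) := (congrArg Parabolic.x hΞY).symm
    have hq : T Ξ.x + V.starProjection p ∈ V :=
      V.add_mem (LinearMap.mem_range_self T _) (V.starProjection_apply_mem p)
    have hdecomp : Y.x = (T Ξ.x + V.starProjection p) + p' := by
      rw [hYx, hT]; simp only [p']; abel
    have hinner : ⟪T Ξ.x + V.starProjection p, p'⟫_ℝ = 0 :=
      Submodule.inner_right_of_mem_orthogonal (K := V) hq hp'
    obtain ⟨h1, h2⟩ := norm_le_norm_add_of_inner_eq_zero hinner
    exact ⟨_, hq, hdecomp, hdecomp ▸ h1, hdecomp ▸ h2⟩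
  by_cases hne : (S ∩ ball (0 : Parabolic (EuclideanSpace ℝ (Fin N))) 1).Nonempty
  swap
  · refine ⟨L', 0, fun X η => by simp, by simp, ?_⟩
    rw [Set.not_nonempty_iff_eq_empty.1 hne]; exact empty_subset _
  obtain ⟨Y₀, hY₀⟩ := hne
  obtain ⟨q₀, -, -, -, hp'le⟩ := key Y₀ hY₀
  have hp'lt : ‖p'‖ < 1 := hp'le.trans_lt ((mem_ball_zero_one_iff _).1 hY₀.2).1
  refine ⟨L', fun _ => p', fun _ η => horth η, ?_, fun Y hY => ?_⟩
  · -- the norm of a constant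
    have hguard : IsC21On (fun _ : Parabolic (EuclideanSpace ℝ (Fin m)) => p') (ball 0 1) :=
      isC21On_const p' _
    have hD2 : spaceDeriv (0 : Parabolic (EuclideanSpace ℝ (Fin m)) →
        (EuclideanSpace ℝ (Fin m) →L[ℝ] EuclideanSpace ℝ (Fin N))) = 0 := spaceDeriv_const _
    rw [c2αNormOn_eq hguard, spaceDeriv_const, timeDeriv_const, hD2]
    simp only [holderNormOn_zero, add_zero]
    rw [holderNormOn_const α p' ⟨0, mem_ball_self one_pos⟩, ← ofReal_norm]
    exact ENNReal.ofReal_le_one.2 hp'lt.le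
  · obtain ⟨q, hq, hYq, hqle, -⟩ := key Y hY
    obtain ⟨ζ, hζ⟩ := hL'surj q hq
    have hYB := (mem_ball_zero_one_iff Y).1 hY.2
    refine mem_parabolicGraph.2 ⟨⟨ζ, Y.t⟩, ?_, ?_⟩
    · rw [mem_ball_zero_one_iff]
      refine ⟨?_, hYB.2⟩
      calc ‖ζ‖ = ‖L' ζ‖ := (L'.norm_map ζ).symm
        _ = ‖q‖ := by rw [hζ]
        _ ≤ ‖Y.x‖ := hqle
        _ < 1 := hYB.1
    · show (⟨L' ζ + p', Y.t⟩ : Parabolic _) = Y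
      rw [hζ, ← hYq]

end Affine


/-! ### The degenerate case of White's Thm. 8.1: blow-down to a plane -/

section BlowDownLimit

/-- **Blow-down limit.**  If every point of `S₀` is a limit of points `Yᵢ ∈ Sᵢ` (eventually), and
each `D_{1/rᵢ} Sᵢ ∩ B^{N,1}` lies on a unit graph with `rᵢ → ∞`, then `S₀ ∩ B^{N,1}` lies on a
unit graph: the blow-downs `rᵢ • uᵢ ∘ D_{1/rᵢ}` have `C^{2,α}` norm `≤ 17` once a point of
`S₀ ∩ B` pins them down, so a subsequence converges (compactness of the `C^{2,α}` ball) to a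
limit with constant `D` and vanishing `∂ₜ`, i.e. an affine function, whose graph is a piece of
an `m`-plane. [cite: White2005, Thm. 8.1] -/
theorem hasUnitGraphBound_of_blowDown {α : ℝ≥0} (hα : 0 < α) (hα1 : α ≤ 1)
    {S : ℕ → Set (Parabolic (EuclideanSpace ℝ (Fin N)))}
    {S₀ : Set (Parabolic (EuclideanSpace ℝ (Fin N)))}
    (hlower : ∀ Y ∈ S₀, ∃ Ys : ℕ → Parabolic (EuclideanSpace ℝ (Fin N)),
      (∀ᶠ i in atTop, Ys i ∈ S i) ∧ Tendsto Ys atTop (𝓝 Y))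
    {r : ℕ → ℝ} (hr1 : ∀ i, 1 ≤ r i) (hr : Tendsto r atTop atTop)
    (hS : ∀ i, HasUnitGraphBound m α (dilation (r i)⁻¹ '' S i)) : HasUnitGraphBound m α S₀ := by
  classical
  choose L u hu hn hsub using hS
  -- the blow-downs and the graphs at scale one
  set W : ℕ → Parabolic (EuclideanSpace ℝ (Fin m)) → EuclideanSpace ℝ (Fin N) :=
    fun i => r i • (u i ∘ dilation (r i)⁻¹) with hWdef
  have hWsub : ∀ i, S i ∩ ball 0 1 ⊆ parabolicGraph (L i) (W i) (ball 0 1) := fun i =>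
    subset_parabolicGraph_blowDown (hu i) (hr1 i) (hsub i)
  have hWorth : ∀ i X η, ⟪W i X, L i η⟫_ℝ = 0 := fun i X η => by
    simp only [hWdef, Pi.smul_apply, Function.comp_apply, real_inner_smul_left, hu, mul_zero]
  -- trivial case: no point of `S₀` in the unit ball
  by_cases hne : (S₀ ∩ ball (0 : Parabolic (EuclideanSpace ℝ (Fin N))) 1).Nonempty
  swap
  · refine ⟨L 0, 0, fun X η => by simp, by simp, ?_⟩
    rw [Set.not_nonempty_iff_eq_empty.1 hne]; exact empty_subset _
  -- a point of `S₀ ∩ B` pins the blow-downs down: `‖W i 0‖ ≤ 3` along a subsequence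
  obtain ⟨Y₀, hY₀S, hY₀B⟩ := hne
  obtain ⟨Ys, hYsS, hYs⟩ := hlower Y₀ hY₀S
  have hYsB : ∀ᶠ i in atTop, Ys i ∈ ball (0 : Parabolic (EuclideanSpace ℝ (Fin N))) 1 :=
    hYs (isOpen_ball.mem_nhds hY₀B)
  obtain ⟨φ₀, hφ₀, hφ₀P⟩ := extraction_of_eventually_atTop (hYsS.and hYsB)
  have hW0 : ∀ n, ‖W (φ₀ n) 0‖ ≤ 3 := by
    intro n
    obtain ⟨hS', hB'⟩ := hφ₀P n
    obtain ⟨Ξ, hΞ, hΞY⟩ := mem_parabolicGraph.1 (hWsub _ ⟨hS', hB'⟩)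
    have hx : L (φ₀ n) Ξ.x + W (φ₀ n) Ξ = (Ys (φ₀ n)).x := congrArg Parabolic.x hΞY
    have h1 : ‖W (φ₀ n) Ξ‖ ≤ ‖(Ys (φ₀ n)).x‖ := by
      rw [← hx]
      exact (norm_le_norm_add_of_inner_eq_zero (x := L (φ₀ n) Ξ.x) (y := W (φ₀ n) Ξ)
        (by rw [real_inner_comm]; exact hWorth _ _ _)).2
    have h2 : ‖(Ys (φ₀ n)).x‖ < 1 := ((mem_ball_zero_one_iff _).1 hB').1
    have h3 := norm_blowDown_sub_le (hn (φ₀ n)) (hr1 (φ₀ n)) hΞ (mem_ball_self one_pos)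
    have hΞB := (mem_ball_zero_one_iff Ξ).1 hΞ
    have hrle : (r (φ₀ n))⁻¹ ≤ 1 := inv_le_one_of_one_le₀ (hr1 _)
    have hr0 : 0 ≤ (r (φ₀ n))⁻¹ := inv_nonneg.2 (zero_le_one.trans (hr1 _))
    simp only [zero_x, zero_t, sub_zero] at h3
    have h4 : ‖Ξ.x‖ + (r (φ₀ n))⁻¹ * |Ξ.t| ≤ 2 := by nlinarith [abs_nonneg Ξ.t, hΞB.1, hΞB.2]
    calc ‖W (φ₀ n) 0‖ ≤ ‖W (φ₀ n) 0 - W (φ₀ n) Ξ‖ + ‖W (φ₀ n) Ξ‖ := norm_le_norm_sub_add _ _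
      _ = ‖W (φ₀ n) Ξ - W (φ₀ n) 0‖ + ‖W (φ₀ n) Ξ‖ := by rw [norm_sub_rev]
      _ ≤ 2 + 1 := add_le_add (h3.trans h4) (h1.trans h2.le)
      _ = 3 := by norm_num
  -- the blow-downs along `φ₀` have norm `≤ 17`; normalise
  have hC : ∀ i, IsC21On (W i) (ball 0 1) := fun i =>
    isC21On_blowDown (bounds_of_c2αNormOn_le_one (hn i)).1 (hr1 i)
  have hnW : ∀ n, c2αNormOn α (W (φ₀ n)) (ball 0 1) ≤ 17 := by
    intro n
    have h1 : ‖W (φ₀ n) 0‖ₑ ≤ 3 := by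
      rw [← ofReal_norm]
      exact ENNReal.ofReal_le_of_le_toReal (by simpa using hW0 n)
    calc c2αNormOn α (W (φ₀ n)) (ball 0 1) ≤ ‖W (φ₀ n) 0‖ₑ + 14 :=
          c2αNormOn_blowDown_le hα hα1 (hn _) (hr1 _)
      _ ≤ 3 + 14 := add_le_add h1 le_rfl
      _ = 17 := by norm_num
  let w : ℕ → Parabolic (EuclideanSpace ℝ (Fin m)) → EuclideanSpace ℝ (Fin N) :=
    fun n => (17 : ℝ)⁻¹ • W (φ₀ n)
  have hw : ∀ n, c2αNormOn α (w n) (ball 0 1) ≤ 1 := by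
    intro n
    show c2αNormOn α ((17 : ℝ)⁻¹ • W (φ₀ n)) (ball 0 1) ≤ 1
    rw [c2αNormOn_const_smul (hC _), Real.enorm_eq_ofReal (by norm_num),
      ENNReal.ofReal_inv_of_pos (by norm_num), ENNReal.ofReal_ofNat]
    calc (17 : ℝ≥0∞)⁻¹ * c2αNormOn α (W (φ₀ n)) (ball 0 1) ≤ (17 : ℝ≥0∞)⁻¹ * 17 := by
          gcongr; exact hnW n
      _ = 1 := ENNReal.inv_mul_cancel (by norm_num) (by norm_num)
  -- the isometries converge along `φ₁`, the normalised blow-downs along a further `φ₂`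
  obtain ⟨φ₁, hφ₁, L₀, hL₀⟩ := exists_subseq_tendsto_linearIsometry fun n => L (φ₀ n)
  obtain ⟨φ₂, hφ₂, v, hv, hcv, hcD, -, hcT⟩ :=
    exists_subseq_tendstoUniformlyOn_of_c2αNormOn_le_one hα (fun n => w (φ₁ n)) fun n => hw _
  set θ : ℕ → ℕ := fun n => φ₀ (φ₁ (φ₂ n)) with hθdef
  have hθ : StrictMono θ := hφ₀.comp (hφ₁.comp hφ₂)
  have hrθ : Tendsto (fun n => r (θ n)) atTop atTop := hr.comp hθ.tendsto_atTop
  have hvC : IsC21On v (ball 0 1) := (bounds_of_c2αNormOn_le_one hv).1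
  have hvcont : ContinuousOn v (ball 0 1) :=
    (holderOnWith_of_holderNormOn_le_one ((holderNormOn_le_c2αNormOn α v _).trans hv)).continuousOn
      hα
  -- `D v` is constant on `B`
  have hDconst : ∀ X ∈ ball (0 : Parabolic (EuclideanSpace ℝ (Fin m))) 1,
      ∀ Y ∈ ball (0 : Parabolic (EuclideanSpace ℝ (Fin m))) 1, spaceDeriv v X = spaceDeriv v Y := by
    intro X hX Y hY
    have h1 : Tendsto (fun n => spaceDeriv (w (φ₁ (φ₂ n))) X - spaceDeriv (w (φ₁ (φ₂ n))) Y) atTop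
        (𝓝 (spaceDeriv v X - spaceDeriv v Y)) := (hcD.tendsto_at hX).sub (hcD.tendsto_at hY)
    have h2 : ∀ n, ‖spaceDeriv (w (φ₁ (φ₂ n))) X - spaceDeriv (w (φ₁ (φ₂ n))) Y‖ ≤
        (17 : ℝ)⁻¹ * ((r (θ n)) ^ (-(α : ℝ)) * dist X Y ^ (α : ℝ)) := by
      intro n
      show ‖spaceDeriv ((17 : ℝ)⁻¹ • W (θ n)) X - spaceDeriv ((17 : ℝ)⁻¹ • W (θ n)) Y‖ ≤ _
      rw [spaceDeriv_const_smul, Pi.smul_apply, Pi.smul_apply, ← smul_sub, norm_smul,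
        Real.norm_of_nonneg (by norm_num)]
      gcongr
      exact norm_spaceDeriv_blowDown_sub_le (hn _) (hr1 _) hX hY
    have h3 : Tendsto (fun n => (17 : ℝ)⁻¹ * ((r (θ n)) ^ (-(α : ℝ)) * dist X Y ^ (α : ℝ))) atTop
        (𝓝 0) := by
      have h : Tendsto (fun n => (r (θ n)) ^ (-(α : ℝ))) atTop (𝓝 0) :=
        (tendsto_rpow_neg_atTop (NNReal.coe_pos.2 hα)).comp hrθ
      simpa using (h.mul_const (dist X Y ^ (α : ℝ))).const_mul (17 : ℝ)⁻¹
    have h4 : ‖spaceDeriv v X - spaceDeriv v Y‖ ≤ 0 := le_of_tendsto_of_tendsto' h1.norm h3 h2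
    exact sub_eq_zero.1 (norm_le_zero_iff.1 h4)
  -- `∂ₜ v = 0` on `B`
  have hTzero : ∀ X ∈ ball (0 : Parabolic (EuclideanSpace ℝ (Fin m))) 1, timeDeriv v X = 0 := by
    intro X hX
    have h1 := hcT.tendsto_at hX
    have h2 : ∀ n, ‖timeDeriv (w (φ₁ (φ₂ n))) X‖ ≤ (17 : ℝ)⁻¹ * (r (θ n))⁻¹ := by
      intro n
      show ‖timeDeriv ((17 : ℝ)⁻¹ • W (θ n)) X‖ ≤ _
      rw [timeDeriv_const_smul, Pi.smul_apply, norm_smul, Real.norm_of_nonneg (by norm_num)]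
      gcongr
      exact norm_timeDeriv_blowDown_le (hn _) (hr1 _) hX
    have h3 : Tendsto (fun n => (17 : ℝ)⁻¹ * (r (θ n))⁻¹) atTop (𝓝 0) := by
      simpa using (tendsto_inv_atTop_zero.comp hrθ).const_mul (17 : ℝ)⁻¹
    exact norm_le_zero_iff.1 (le_of_tendsto_of_tendsto' h1.norm h3 h2)
  -- hence `v` is affine on `B`
  have hvaff : ∀ X ∈ ball (0 : Parabolic (EuclideanSpace ℝ (Fin m))) 1,
      v X = v 0 + spaceDeriv v 0 X.x := fun X hX =>
    eq_add_of_spaceDeriv_eq_const hvC (fun Y hY => hDconst Y hY 0 (mem_ball_self one_pos)) hTzero hX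
  -- the unscaled limit `17 • v` is the uniform limit of the blow-downs along `θ`
  have hconvW : TendstoUniformlyOn (fun n => W (θ n)) ((17 : ℝ) • v) atTop (ball 0 1) := by
    refine ((uniformContinuous_const_smul (17 : ℝ)).comp_tendstoUniformlyOn hcv).congr ?_
    refine Eventually.of_forall fun n X _ => ?_
    show (17 : ℝ) • ((17 : ℝ)⁻¹ • W (φ₀ (φ₁ (φ₂ n)))) X = W (θ n) X
    rw [Pi.smul_apply, smul_smul, mul_inv_cancel₀ (by norm_num), one_smul]
  have hVcont : ContinuousOn ((17 : ℝ) • v) (ball 0 1) := hvcont.const_smul (17 : ℝ)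
  have hL₀' : Tendsto (fun n => (L (θ n)).toContinuousLinearMap) atTop
      (𝓝 L₀.toContinuousLinearMap) := hL₀.comp hφ₂.tendsto_atTop
  -- the limit values are normal to `L₀`
  have hVorth : ∀ X ∈ ball (0 : Parabolic (EuclideanSpace ℝ (Fin m))) 1, ∀ η,
      ⟪((17 : ℝ) • v) X, L₀ η⟫_ℝ = 0 := by
    intro X hX η
    have h1 : Tendsto (fun n => ⟪W (θ n) X, L (θ n) η⟫_ℝ) atTop (𝓝 ⟪((17 : ℝ) • v) X, L₀ η⟫_ℝ) := by
      refine (hconvW.tendsto_at hX).inner ?_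
      exact ((ContinuousLinearMap.apply ℝ (EuclideanSpace ℝ (Fin N)) η).continuous.tendsto
        L₀.toContinuousLinearMap).comp hL₀'
    have h2 : (fun n => ⟪W (θ n) X, L (θ n) η⟫_ℝ) = fun _ => 0 := funext fun n => hWorth _ _ _
    rw [h2] at h1
    exact (tendsto_const_nhds_iff.1 h1).symm
  -- the linear part `17 • D v (0)` is normal to `L₀`
  have hA' : ∀ ξ η, ⟪((17 : ℝ) • spaceDeriv v 0) ξ, L₀ η⟫_ℝ = 0 := by
    intro ξ η
    set s : ℝ := (‖ξ‖ + 1)⁻¹ with hs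
    have hs0 : 0 < s := inv_pos.2 (by positivity)
    have hsξ : ‖s • ξ‖ < 1 := by
      rw [norm_smul, Real.norm_of_nonneg hs0.le, hs, inv_mul_lt_iff₀ (by positivity)]
      linarith [norm_nonneg ξ]
    have hmem : (⟨s • ξ, 0⟩ : Parabolic (EuclideanSpace ℝ (Fin m))) ∈
        ball (0 : Parabolic (EuclideanSpace ℝ (Fin m))) 1 := by
      rw [mem_ball_zero_one_iff]; exact ⟨hsξ, by simp⟩
    have h1 := hVorth _ hmem η
    have h0 := hVorth 0 (mem_ball_self one_pos) η
    have hv1 : ((17 : ℝ) • v) ⟨s • ξ, 0⟩ =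
        ((17 : ℝ) • v) 0 + s • (((17 : ℝ) • spaceDeriv v 0) ξ) := by
      simp only [Pi.smul_apply, FunLike.coe_smul]
      rw [hvaff _ hmem, smul_add, map_smul, smul_comm]
    rw [hv1, inner_add_left, h0, zero_add, real_inner_smul_left] at h1
    rcases mul_eq_zero.1 h1 with h | h
    · exact absurd h hs0.ne'
    · exact h
  -- containment in the limit graph, hence in an affine graph
  have hsub0 : S₀ ∩ ball 0 1 ⊆ parabolicGraph L₀ ((17 : ℝ) • v) (ball 0 1) := by
    intro Y hY
    obtain ⟨Zs, hZsS, hZs⟩ := hlower Y hY.1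
    have hZsB : ∀ᶠ i in atTop, Zs i ∈ ball (0 : Parabolic (EuclideanSpace ℝ (Fin N))) 1 :=
      hZs (isOpen_ball.mem_nhds hY.2)
    have hmem : ∀ᶠ i in atTop, Zs i ∈ parabolicGraph (L i) (W i) (ball 0 1) :=
      (hZsS.and hZsB).mono fun i hi => hWsub i hi
    exact mem_parabolicGraph_of_tendsto (L := fun n => L (θ n)) (u := fun n => W (θ n)) hL₀'
      (fun n X η => hWorth _ _ _) hconvW hVcont (hZs.comp hθ.tendsto_atTop) hY.2
      (hθ.tendsto_atTop.eventually hmem)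
  have hsub1 : S₀ ∩ ball 0 1 ⊆ parabolicGraph L₀
      (fun X => ((17 : ℝ) • v) 0 + ((17 : ℝ) • spaceDeriv v 0) X.x) (ball 0 1) := by
    intro Y hY
    obtain ⟨Ξ, hΞ, hΞY⟩ := mem_parabolicGraph.1 (hsub0 hY)
    refine mem_parabolicGraph.2 ⟨Ξ, hΞ, ?_⟩
    rw [← hΞY]
    simp only [Pi.smul_apply, FunLike.coe_smul]
    rw [hvaff Ξ hΞ, smul_add]
  exact hasUnitGraphBound_of_subset_affineGraph L₀ (((17 : ℝ) • v) 0) ((17 : ℝ) • spaceDeriv v 0)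
    hA' hsub1

end BlowDownLimit

/-! ### White's Theorem 8.1, degenerate case and final form -/

section LSCFinal

/-- **White 2005, Thm. 8.1, degenerate case**: if `lim inf K_{2,α}(𝓜ᵢ, Xᵢ) = 0` then
`K_{2,α}(𝓜, X) = 0` (every scale is good for the limit: blow the graphs down to a plane).
[cite: White2005, Thm. 8.1] -/
theorem k2α_eq_zero_of_liminf_eq_zero {α : ℝ≥0} (hα : 0 < α) (hα1 : α ≤ 1)
    {M : ℕ → Set (Parabolic (EuclideanSpace ℝ (Fin N)))}
    {M₀ : Set (Parabolic (EuclideanSpace ℝ (Fin N)))}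
    (hlower : ∀ Z ∈ M₀, ∃ Zs : ℕ → Parabolic (EuclideanSpace ℝ (Fin N)),
      (∀ᶠ i in atTop, Zs i ∈ M i) ∧ Tendsto Zs atTop (𝓝 Z))
    {X : ℕ → Parabolic (EuclideanSpace ℝ (Fin N))} {X₀ : Parabolic (EuclideanSpace ℝ (Fin N))}
    (hX : Tendsto X atTop (𝓝 X₀))
    (h0 : liminf (fun i => k2α m α (M i) (X i)) atTop = 0) : k2α m α M₀ X₀ = 0 := by
  refine le_antisymm (le_of_forall_gt_imp_ge_of_dense fun d hd => ?_) bot_le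
  rcases eq_or_ne d ∞ with rfl | hdtop
  · exact le_top
  have hd' : 0 < d.toReal := ENNReal.toReal_pos hd.ne' hdtop
  -- good scales below every threshold, for infinitely many `i`
  have hfreq : ∀ n : ℕ, ∃ᶠ i in atTop, ∃ c : ℝ, 0 < c ∧ c < d.toReal / (n + 1) ∧
      HasUnitGraphBound m α (dilation c '' ((· - X i) '' M i)) := by
    intro n
    have hlt : liminf (fun i => k2α m α (M i) (X i)) atTop <
        ENNReal.ofReal (d.toReal / (n + 1)) := by
      rw [h0]; exact ENNReal.ofReal_pos.2 (by positivity)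
    refine (frequently_lt_of_liminf_lt (by isBoundedDefault) hlt).mono fun i hi => ?_
    simp only [k2α, iInf_lt_iff] at hi
    obtain ⟨c, hc0, hcg, hcd⟩ := hi
    exact ⟨c, hc0, (ENNReal.ofReal_lt_ofReal_iff (by positivity)).1 hcd, hcg⟩
  obtain ⟨φ, hφ, hφP⟩ := extraction_forall_of_frequently hfreq
  choose c hc0 hcd hcg using hφP
  -- blow-down factors `rₙ = d / cₙ ≥ n + 1`
  have hr1 : ∀ n : ℕ, (n : ℝ) + 1 ≤ d.toReal / c n := fun n => by
    rw [le_div_iff₀ (hc0 n)]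
    have h := hcd n
    rw [lt_div_iff₀ (by positivity)] at h
    linarith
  have hr1' : ∀ n, 1 ≤ d.toReal / c n := fun n =>
    le_trans (by have := Nat.cast_nonneg (α := ℝ) n; linarith) (hr1 n)
  have hr : Tendsto (fun n => d.toReal / c n) atTop atTop :=
    tendsto_atTop_mono hr1 (tendsto_atTop_add_const_right _ 1 tendsto_natCast_atTop_atTop)
  have key := hasUnitGraphBound_of_blowDown (m := m) hα hα1
    (S := fun n => dilation d.toReal '' ((· - X (φ n)) '' M (φ n)))
    (S₀ := dilation d.toReal '' ((· - X₀) '' M₀)) ?_ hr1' hr ?_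
  · calc k2α m α M₀ X₀ ≤ ENNReal.ofReal d.toReal := k2α_le hd' key
      _ = d := ENNReal.ofReal_toReal hdtop
  · rintro Y ⟨W, ⟨Z, hZ, rfl⟩, rfl⟩
    obtain ⟨Zs, hZsM, hZs⟩ := hlower Z hZ
    refine ⟨fun n => dilation d.toReal (Zs (φ n) - X (φ n)), ?_, ?_⟩
    · exact (hφ.tendsto_atTop.eventually hZsM).mono fun n hn => ⟨_, ⟨_, hn, rfl⟩, rfl⟩
    · exact tendsto_dilation_sub tendsto_const_nhds (hZs.comp hφ.tendsto_atTop)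
        (hX.comp hφ.tendsto_atTop)
  · intro n
    have h : dilation (d.toReal / c n)⁻¹ '' (dilation d.toReal '' ((· - X (φ n)) '' M (φ n))) =
        dilation (c n) '' ((· - X (φ n)) '' M (φ n)) := by
      rw [image_image]
      refine image_congr fun W _ => ?_
      rw [dilation_dilation]
      congr 1
      field_simp
    rw [h]
    exact hcg n

/-- **White 2005, Thm. 8.1 (lower semicontinuity of `K_{2,α}` under convergence of sets).**
"Suppose `𝓜ᵢ` are sets in `R^{N,1}` that converge to `𝓜` as sets. Suppose that `Xᵢ ∈ 𝓜ᵢ`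
converge to `X ∈ 𝓜`. Then `K_{2,α}(𝓜, X) ≤ lim inf K_{2,α}(𝓜ᵢ, Xᵢ)`."  Of the set convergence
only the lower half is used (every point of `𝓜` is a limit of points `Zᵢ ∈ 𝓜ᵢ`, eventually),
and the memberships `Xᵢ ∈ 𝓜ᵢ`, `X ∈ 𝓜` are not needed; `0 < α ≤ 1` as in the source
(`0 < α < 1`).  Proof: `k2α_le_liminf_of_liminf_pos` (White's argument, positive limit) and
`k2α_eq_zero_of_liminf_eq_zero` (degenerate case). [cite: White2005, Thm. 8.1] -/
theorem k2α_le_liminf {α : ℝ≥0} (hα : 0 < α) (hα1 : α ≤ 1)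
    {M : ℕ → Set (Parabolic (EuclideanSpace ℝ (Fin N)))}
    {M₀ : Set (Parabolic (EuclideanSpace ℝ (Fin N)))}
    (hlower : ∀ Z ∈ M₀, ∃ Zs : ℕ → Parabolic (EuclideanSpace ℝ (Fin N)),
      (∀ᶠ i in atTop, Zs i ∈ M i) ∧ Tendsto Zs atTop (𝓝 Z))
    {X : ℕ → Parabolic (EuclideanSpace ℝ (Fin N))} {X₀ : Parabolic (EuclideanSpace ℝ (Fin N))}
    (hX : Tendsto X atTop (𝓝 X₀)) :
    k2α m α M₀ X₀ ≤ liminf (fun i => k2α m α (M i) (X i)) atTop := by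
  rcases eq_or_ne (liminf (fun i => k2α m α (M i) (X i)) atTop) 0 with h0 | hpos
  · rw [k2α_eq_zero_of_liminf_eq_zero hα hα1 hlower hX h0]; exact bot_le
  · exact k2α_le_liminf_of_liminf_pos hα hlower hX (pos_iff_ne_zero.2 hpos)

end LSCFinal

/-! ### White's Corollary 2.7: lower semicontinuity of `K_{2,α;U}` -/

section Cor27

/-- **`d(X, U) ≤ lim inf d(Xᵢ, Uᵢ)`** when `Xᵢ → X` and `Uᵢᶜ → Uᶜ` in the upper Kuratowski
sense (limits of convergent sequences `Yₙ ∈ (U_{φ n})ᶜ` along subsequences lie in `Uᶜ`; White: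
"for every bounded sequence `Xᵢ ∈ Sᵢ`, all subsequential limits lie in `S`").
[cite: White2005, §2.6–2.7] -/
theorem edistCompl_le_liminf {U : ℕ → Set (Parabolic (EuclideanSpace ℝ (Fin N)))}
    {U₀ : Set (Parabolic (EuclideanSpace ℝ (Fin N)))}
    (hupper : ∀ φ : ℕ → ℕ, StrictMono φ → ∀ Y : ℕ → Parabolic (EuclideanSpace ℝ (Fin N)),
      (∀ n, Y n ∈ (U (φ n))ᶜ) → ∀ Y₀, Tendsto Y atTop (𝓝 Y₀) → Y₀ ∈ U₀ᶜ)
    {Xs : ℕ → Parabolic (EuclideanSpace ℝ (Fin N))} {X : Parabolic (EuclideanSpace ℝ (Fin N))}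
    (hXs : Tendsto Xs atTop (𝓝 X)) :
    edistCompl X U₀ ≤ liminf (fun i => edistCompl (Xs i) (U i)) atTop := by
  refine le_of_forall_gt_imp_ge_of_dense fun b hb => ?_
  rcases eq_or_ne b ∞ with rfl | hbtop
  · exact le_top
  -- points of the complements within distance `b`, for infinitely many `i`
  have hfreq : ∃ᶠ i in atTop, ∃ Y ∈ (U i)ᶜ, edist (Xs i) Y < b :=
    (frequently_lt_of_liminf_lt (by isBoundedDefault) hb).mono fun i hi => by
      rwa [edistCompl_eq, Metric.infEDist_lt_iff] at hi
  obtain ⟨φ, hφ, hφP⟩ := extraction_of_frequently_atTop hfreq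
  choose Y hYU hYd using hφP
  have hXsφ : Tendsto (fun n => Xs (φ n)) atTop (𝓝 X) := hXs.comp hφ.tendsto_atTop
  -- the `Y n` are eventually in a compact ball around `X`
  have hev : ∀ᶠ n in atTop, Y n ∈ closedBall X (b.toReal + 1) := by
    have h1 : ∀ᶠ n in atTop, Xs (φ n) ∈ ball X 1 :=
      hXsφ (isOpen_ball.mem_nhds (mem_ball_self one_pos))
    refine h1.mono fun n hn => ?_
    rw [mem_ball] at hn
    have h2 : dist (Y n) (Xs (φ n)) < b.toReal := by
      have h := hYd n
      rwa [edist_comm, edist_dist, ENNReal.ofReal_lt_iff_lt_toReal dist_nonneg hbtop] at h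
    rw [mem_closedBall]
    calc dist (Y n) X ≤ dist (Y n) (Xs (φ n)) + dist (Xs (φ n)) X := dist_triangle _ _ _
      _ ≤ b.toReal + 1 := by linarith
  obtain ⟨ψ₀, hψ₀, hψ₀P⟩ := extraction_of_eventually_atTop hev
  obtain ⟨Y₀, -, ψ, hψ, hYconv⟩ :=
    (isCompact_closedBall X (b.toReal + 1)).tendsto_subseq (x := fun n => Y (ψ₀ n)) hψ₀P
  -- its limit lies in `U₀ᶜ`, at distance `≤ b` from `X`
  have hY₀ : Y₀ ∈ U₀ᶜ := hupper (fun n => φ (ψ₀ (ψ n))) (hφ.comp (hψ₀.comp hψ))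
    (fun n => Y (ψ₀ (ψ n))) (fun n => hYU _) Y₀ hYconv
  have hle : edist X Y₀ ≤ b := by
    have h1 : Tendsto (fun n => edist (Xs (φ (ψ₀ (ψ n)))) (Y (ψ₀ (ψ n)))) atTop
        (𝓝 (edist X Y₀)) := (hXsφ.comp (hψ₀.comp hψ).tendsto_atTop).edist hYconv
    exact le_of_tendsto' h1 fun n => (hYd _).le
  exact (Metric.infEDist_le_edist_of_mem hY₀).trans hle

/-- **White 2005, Cor. 2.7 (to the Arzelà–Ascoli theorem):
`K_{2,α;U}(𝓜′) ≤ lim inf K_{2,α;Uᵢ}(𝓜ᵢ)`**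
for `𝓜′ = 𝓜 ∩ U`, when `𝓜ᵢ → 𝓜` (lower half of set convergence: every point of `𝓜` is a limit
of points `Zᵢ ∈ 𝓜ᵢ`, eventually) and `Uᵢᶜ → Uᶜ` (upper half: subsequential limits of sequences
in the complements lie in `Uᶜ`); `0 < α ≤ 1`.  Proof: for `X ∈ 𝓜′` and `Xᵢ ∈ 𝓜ᵢ`, `Xᵢ → X`:
`d(X, U) ≤ lim inf d(Xᵢ, Uᵢ)` (`edistCompl_le_liminf`), `K_{2,α}(𝓜′, X) ≤ K_{2,α}(𝓜, X) ≤
lim inf K_{2,α}(𝓜ᵢ, Xᵢ)` (Thm. 8.1, `k2α_le_liminf`), and `lim inf` is super-multiplicative.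
[cite: White2005, Cor. 2.7] -/
theorem k2αOn_inter_le_liminf {α : ℝ≥0} (hα : 0 < α) (hα1 : α ≤ 1)
    {M : ℕ → Set (Parabolic (EuclideanSpace ℝ (Fin N)))}
    {M₀ : Set (Parabolic (EuclideanSpace ℝ (Fin N)))}
    (hlower : ∀ Z ∈ M₀, ∃ Zs : ℕ → Parabolic (EuclideanSpace ℝ (Fin N)),
      (∀ᶠ i in atTop, Zs i ∈ M i) ∧ Tendsto Zs atTop (𝓝 Z))
    {U : ℕ → Set (Parabolic (EuclideanSpace ℝ (Fin N)))}
    {U₀ : Set (Parabolic (EuclideanSpace ℝ (Fin N)))}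
    (hupper : ∀ φ : ℕ → ℕ, StrictMono φ → ∀ Y : ℕ → Parabolic (EuclideanSpace ℝ (Fin N)),
      (∀ n, Y n ∈ (U (φ n))ᶜ) → ∀ Y₀, Tendsto Y atTop (𝓝 Y₀) → Y₀ ∈ U₀ᶜ) :
    k2αOn m α (M₀ ∩ U₀) U₀ ≤ liminf (fun i => k2αOn m α (M i) (U i)) atTop := by
  rw [k2αOn_le_iff]
  intro X hX
  obtain ⟨Xs, hXsM, hXs⟩ := hlower X hX.1
  have hK : k2α m α (M₀ ∩ U₀) X ≤ liminf (fun i => k2α m α (M i) (Xs i)) atTop :=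
    (k2α_mono m α inter_subset_left X).trans (k2α_le_liminf hα hα1 hlower hXs)
  have hd : edistCompl X U₀ ≤ liminf (fun i => edistCompl (Xs i) (U i)) atTop :=
    edistCompl_le_liminf hupper hXs
  calc edistCompl X U₀ * k2α m α (M₀ ∩ U₀) X
      ≤ liminf (fun i => edistCompl (Xs i) (U i)) atTop *
          liminf (fun i => k2α m α (M i) (Xs i)) atTop := mul_le_mul' hd hK
    _ ≤ liminf ((fun i => edistCompl (Xs i) (U i)) * fun i => k2α m α (M i) (Xs i)) atTop :=
        ENNReal.le_liminf_mul
    _ ≤ liminf (fun i => k2αOn m α (M i) (U i)) atTop :=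
        liminf_le_liminf (hXsM.mono fun i hi => edistCompl_mul_k2α_le_k2αOn m α (U i) hi)

end Cor27

/-! ### White's Proposition 2.8: exhaustion of `U` -/

section Exhaustion

/-- `d(X, U)` is monotone in `U`. [cite: White2005, §2.6 p. 1495] -/
theorem edistCompl_mono {U V : Set (Parabolic (EuclideanSpace ℝ (Fin N)))} (h : U ⊆ V)
    (X : Parabolic (EuclideanSpace ℝ (Fin N))) : edistCompl X U ≤ edistCompl X V :=
  Metric.infEDist_anti (compl_subset_compl.2 h)

/-- `K_{2,α;U}(𝓜 ∩ U)` is monotone in the open set `U`. [cite: White2005, Prop. 2.8] -/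
theorem k2αOn_inter_mono {α : ℝ≥0} {M U V : Set (Parabolic (EuclideanSpace ℝ (Fin N)))}
    (h : U ⊆ V) : k2αOn m α (M ∩ U) U ≤ k2αOn m α (M ∩ V) V := by
  rw [k2αOn_le_iff]
  intro X hX
  calc edistCompl X U * k2α m α (M ∩ U) X ≤ edistCompl X V * k2α m α (M ∩ V) X :=
        mul_le_mul' (edistCompl_mono h X) (k2α_mono m α (inter_subset_inter_right _ h) X)
    _ ≤ k2αOn m α (M ∩ V) V := edistCompl_mul_k2α_le_k2αOn m α V ⟨hX.1, h hX.2⟩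

/-- Closed parabolic balls of radius `< d(X, U)` lie in `U`. [cite: White2005, §2.6 p. 1495] -/
theorem closedBall_subset_of_lt_edistCompl {U : Set (Parabolic (EuclideanSpace ℝ (Fin N)))}
    {X : Parabolic (EuclideanSpace ℝ (Fin N))} {r : ℝ} (hr : ENNReal.ofReal r < edistCompl X U) :
    closedBall X r ⊆ U := by
  intro Y hY
  by_contra hYU
  have h1 : edistCompl X U ≤ edist X Y := Metric.infEDist_le_edist_of_mem hYU
  have h2 : edist X Y ≤ ENNReal.ofReal r := by
    rw [edist_dist, dist_comm]; exact ENNReal.ofReal_le_ofReal (mem_closedBall.1 hY)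
  exact (hr.trans_le (h1.trans h2)).false

/-- **`sup_i d(X, Uᵢ) = d(X, ⋃ Uᵢ)`** for an increasing sequence of open sets: a closed parabolic
ball inside the union (closed balls are compact) lies in one `U_j`.
[cite: White2005, Prop. 2.8] -/
theorem iSup_edistCompl_eq {U : ℕ → Set (Parabolic (EuclideanSpace ℝ (Fin N)))}
    (hmono : Monotone U) (hopen : ∀ i, IsOpen (U i)) (X : Parabolic (EuclideanSpace ℝ (Fin N))) :
    ⨆ i, edistCompl X (U i) = edistCompl X (⋃ i, U i) := by
  refine le_antisymm (iSup_le fun i => edistCompl_mono (subset_iUnion U i) X) ?_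
  refine le_of_forall_lt fun c hc => ?_
  obtain ⟨r, -, hcr, hrd⟩ := ENNReal.lt_iff_exists_real_btwn.1 hc
  have hsub : closedBall X r ⊆ ⋃ i, U i := closedBall_subset_of_lt_edistCompl hrd
  obtain ⟨j, hj⟩ :=
    (isCompact_closedBall X r).elim_directed_cover U hopen hsub hmono.directed_le
  refine lt_of_lt_of_le hcr (le_trans ?_ (le_iSup (fun i => edistCompl X (U i)) j))
  rw [edistCompl_eq, Metric.le_infEDist]
  intro Y hY
  have hYr : r < dist X Y :=
    lt_of_not_ge fun h => hY (hj (by rw [mem_closedBall, dist_comm]; exact h))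
  rw [edist_dist]
  exact ENNReal.ofReal_le_ofReal hYr.le

/-- `d(X, Uᵢ) → d(X, ⋃ Uᵢ)` along an increasing sequence of open sets.
[cite: White2005, Prop. 2.8] -/
theorem tendsto_edistCompl {U : ℕ → Set (Parabolic (EuclideanSpace ℝ (Fin N)))}
    (hmono : Monotone U) (hopen : ∀ i, IsOpen (U i)) (X : Parabolic (EuclideanSpace ℝ (Fin N))) :
    Tendsto (fun i => edistCompl X (U i)) atTop (𝓝 (edistCompl X (⋃ i, U i))) := by
  rw [← iSup_edistCompl_eq hmono hopen X]
  exact tendsto_atTop_iSup fun i j hij => edistCompl_mono (hmono hij) X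

/-- **White 2005, Prop. 2.8 (exhaustion).**  "Let `U₁ ⊂ U₂ ⊂ …` be open sets such that … `∪ Uᵢ = U`.
Then … `K_{2,α;U}(𝓜) = lim K_{2,α;Uᵢ}(𝓜 ∩ Uᵢ)`."  Here for an ARBITRARY subset `𝓜` of spacetime
(with `𝓜 ∩ U` in place of White's proper flow `𝓜` in `U`) and `0 < α ≤ 1`: the sequence is
increasing (`k2αOn_inter_mono`) and bounded by the limit, and the reverse inequality is Cor. 2.7
(`k2αOn_inter_le_liminf`) for `𝓜ᵢ = 𝓜 ∩ Uᵢ → 𝓜 ∩ U`, `Uᵢᶜ → Uᶜ`.  (White's additional assertion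
`K_{2,α;Uᵢ}(𝓜 ∩ Uᵢ) < ∞` for proper `C^{2,α}` flows and compactly contained `Uᵢ` is not needed
for the limit.) [cite: White2005, Prop. 2.8] -/
theorem tendsto_k2αOn_inter {α : ℝ≥0} (hα : 0 < α) (hα1 : α ≤ 1)
    {M : Set (Parabolic (EuclideanSpace ℝ (Fin N)))}
    {U : ℕ → Set (Parabolic (EuclideanSpace ℝ (Fin N)))} (hmono : Monotone U)
    (hopen : ∀ i, IsOpen (U i)) :
    Tendsto (fun i => k2αOn m α (M ∩ U i) (U i)) atTop
      (𝓝 (k2αOn m α (M ∩ ⋃ i, U i) (⋃ i, U i))) := by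
  have hmono' : Monotone fun i => k2αOn m α (M ∩ U i) (U i) := fun i j hij =>
    k2αOn_inter_mono (hmono hij)
  have hle : ∀ i, k2αOn m α (M ∩ U i) (U i) ≤ k2αOn m α (M ∩ ⋃ i, U i) (⋃ i, U i) := fun i =>
    k2αOn_inter_mono (subset_iUnion U i)
  have hsup : ⨆ i, k2αOn m α (M ∩ U i) (U i) = k2αOn m α (M ∩ ⋃ i, U i) (⋃ i, U i) := by
    refine le_antisymm (iSup_le hle) ?_
    have h27 := k2αOn_inter_le_liminf (m := m) hα hα1 (M := fun i => M ∩ U i)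
      (M₀ := M ∩ ⋃ i, U i) ?_ (U := U) (U₀ := ⋃ i, U i) ?_
    · rw [inter_assoc, inter_self] at h27
      exact h27.trans (le_trans liminf_le_limsup limsup_le_iSup)
    · rintro Z ⟨hZM, hZU⟩
      obtain ⟨j, hj⟩ := mem_iUnion.1 hZU
      exact ⟨fun _ => Z, eventually_atTop.2 ⟨j, fun i hi => ⟨hZM, hmono hi hj⟩⟩, tendsto_const_nhds⟩
    · intro φ hφ Y hY Y₀ hY₀ hmem
      obtain ⟨j, hj⟩ := mem_iUnion.1 hmem
      have hev : ∀ᶠ n in atTop, Y n ∈ U j := hY₀ ((hopen j).mem_nhds hj)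
      obtain ⟨n, hn⟩ := (hev.and (eventually_ge_atTop j)).exists
      exact hY n (hmono (hn.2.trans (hφ.id_le n)) hn.1)
  rw [← hsup]
  exact tendsto_atTop_iSup hmono'

end Exhaustion

/-! ### Planes have `K_{2,α} = 0` -/

section Plane

/-- A subset of a (spacetime) `m`-plane `(p + range L) × ℝ` has the unit graph bound at the points
of the plane: `S ∩ B^{N,1}` lies on the graph of the constant `0` over `L` once `p ∈ range L`…
precisely, if every point of `S` has spatial part in `range L`, then `HasUnitGraphBound m α S`.
[cite: White2005, §2.5] -/
theorem hasUnitGraphBound_of_subset_plane {α : ℝ≥0}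
    (L : EuclideanSpace ℝ (Fin m) →ₗᵢ[ℝ] EuclideanSpace ℝ (Fin N))
    {S : Set (Parabolic (EuclideanSpace ℝ (Fin N)))} (hS : ∀ Y ∈ S, Y.x ∈ Set.range L) :
    HasUnitGraphBound m α S := by
  refine hasUnitGraphBound_of_subset_affineGraph L 0 0 (fun ξ η => by simp) ?_
  rintro Y ⟨hYS, hYB⟩
  obtain ⟨ξ, hξ⟩ := hS Y hYS
  obtain ⟨hYx, hYt⟩ := (mem_ball_zero_one_iff Y).1 hYB
  refine mem_parabolicGraph.2 ⟨⟨ξ, Y.t⟩, ?_, ?_⟩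
  · rw [mem_ball_zero_one_iff]
    exact ⟨by rw [← L.norm_map ξ, hξ]; exact hYx, hYt⟩
  · cases Y
    simp only at hξ ⊢
    rw [← hξ]
    congr 1
    simp

/-- **Planes have `K_{2,α} = 0`**: if `𝓜 ⊆ (p + V) × ℝ` for an `m`-plane `V = range L` and
`X ∈ 𝓜` — more generally `X.x ∈ p + V` — then `K_{2,α}(𝓜; X) = 0` (every scale is good: after
translating by `-X` and dilating, the set stays in `V × ℝ`). This is the normal form of the blow-up
limits in White's proofs of Thms. 3.1/4.1 ("`𝓜 = R^m × [0]^{N-m} × (-∞, T]`").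
[cite: White2005, §2.5, §3 p. 1499] -/
theorem k2α_eq_zero_of_subset_plane {α : ℝ≥0}
    (L : EuclideanSpace ℝ (Fin m) →ₗᵢ[ℝ] EuclideanSpace ℝ (Fin N)) (p : EuclideanSpace ℝ (Fin N))
    {M : Set (Parabolic (EuclideanSpace ℝ (Fin N)))} (hM : ∀ Y ∈ M, Y.x - p ∈ Set.range L)
    {X : Parabolic (EuclideanSpace ℝ (Fin N))} (hX : X.x - p ∈ Set.range L) :
    k2α m α M X = 0 := by
  refine le_antisymm (le_of_forall_gt_imp_ge_of_dense fun d hd => ?_) bot_le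
  rcases eq_or_ne d ∞ with rfl | hdtop
  · exact le_top
  have hd' : 0 < d.toReal := ENNReal.toReal_pos hd.ne' hdtop
  have hplane : ∀ Y ∈ dilation d.toReal '' ((· - X) '' M), Y.x ∈ Set.range L := by
    rintro Y ⟨W, ⟨Z, hZ, rfl⟩, rfl⟩
    obtain ⟨ξ, hξ⟩ := hM Z hZ
    obtain ⟨η, hη⟩ := hX
    refine ⟨d.toReal • (ξ - η), ?_⟩
    rw [dilation_x, sub_x, L.map_smul, map_sub, hξ, hη]
    congr 1
    abel
  calc k2α m α M X ≤ ENNReal.ofReal d.toReal :=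
        k2α_le hd' (hasUnitGraphBound_of_subset_plane L hplane)
    _ = d := ENNReal.ofReal_toReal hdtop

end Plane

/-! ### The uniform bound of White's blow-up normalization (p. 1498) -/

section Normalization

/-- `d(·, U)` is `1`-Lipschitz for the parabolic distance: `d(X₀, U) ≤ d(X, U) + ‖X - X₀‖`.
[cite: White2005, §2.6 p. 1495] -/
theorem edistCompl_le_edistCompl_add_edist (X₀ X : Parabolic (EuclideanSpace ℝ (Fin N)))
    (U : Set (Parabolic (EuclideanSpace ℝ (Fin N)))) :
    edistCompl X₀ U ≤ edistCompl X U + edist X₀ X :=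
  Metric.infEDist_le_infEDist_add_edist

/-- Points of an open set are at positive distance from its complement. [cite: White2005, §2.6] -/
theorem edistCompl_pos {U : Set (Parabolic (EuclideanSpace ℝ (Fin N)))} (hU : IsOpen U)
    {X : Parabolic (EuclideanSpace ℝ (Fin N))} (hX : X ∈ U) : 0 < edistCompl X U := by
  rw [edistCompl_eq, Metric.infEDist_pos_iff_notMem_closure, hU.isClosed_compl.closure_eq]
  exact fun h => h hX

/-- **The uniform `K_{2,α}` bound of White's normalization** (proof of Thm. 3.1, p. 1498): if
`K_{2,α;U}(𝓜) ≤ s` then for `X ∈ 𝓜` within parabolic distance `d(X₀, U)` of a point `X₀`,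
`K_{2,α}(𝓜, X) ≤ s / (d(X₀, U) - ‖X - X₀‖)` ("`K_{2,α}(𝓜ᵢ, X) ≤ sᵢ/d(X, Uᵢ) ≤ 2 d(0, Uᵢ)/(d(0, Uᵢ) -
‖X‖)`", whence `K_{2,α}(𝓜ᵢ, ·)` is uniformly bounded on compact subsets of spacetime once
`d(0, Uᵢ) → ∞`). [cite: White2005, Thm. 3.1 proof, p. 1498] -/
theorem k2α_le_div_of_k2αOn_le {α : ℝ≥0} {M U : Set (Parabolic (EuclideanSpace ℝ (Fin N)))}
    {s : ℝ≥0∞} (hs : s ≠ ∞) (hK : k2αOn m α M U ≤ s)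
    {X : Parabolic (EuclideanSpace ℝ (Fin N))} (hX : X ∈ M)
    (X₀ : Parabolic (EuclideanSpace ℝ (Fin N))) (hlt : edist X₀ X < edistCompl X₀ U) :
    k2α m α M X ≤ s / (edistCompl X₀ U - edist X₀ X) := by
  have h1 : edistCompl X U * k2α m α M X ≤ s := (edistCompl_mul_k2α_le_k2αOn m α U hX).trans hK
  have h2 : edistCompl X₀ U - edist X₀ X ≤ edistCompl X U :=
    tsub_le_iff_right.2 (edistCompl_le_edistCompl_add_edist X₀ X U)
  have hpos : edistCompl X₀ U - edist X₀ X ≠ 0 := (tsub_pos_iff_lt.2 hlt).ne'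
  rw [ENNReal.le_div_iff_mul_le (Or.inl hpos) (Or.inr hs), mul_comm]
  exact (mul_le_mul' h2 le_rfl).trans h1

/-- The normalized form used by White: if `K_{2,α;U}(𝓜) ≤ s < ∞` and
`d(X₀, U) K_{2,α}(𝓜, X₀) ≥ s/2` with `K_{2,α}(𝓜, X₀) = 1`, then for `X ∈ 𝓜` with
`‖X - X₀‖ < d(X₀, U)`:
`K_{2,α}(𝓜, X) ≤ 2 d(X₀, U) / (d(X₀, U) - ‖X - X₀‖)`. [cite: White2005, Thm. 3.1 proof, p. 1498] -/
theorem k2α_le_of_normalization {α : ℝ≥0} {M U : Set (Parabolic (EuclideanSpace ℝ (Fin N)))}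
    {s : ℝ≥0∞} (hs : s ≠ ∞) (hK : k2αOn m α M U ≤ s) {X₀ : Parabolic (EuclideanSpace ℝ (Fin N))}
    (h0 : s ≤ 2 * (edistCompl X₀ U * k2α m α M X₀)) (h1 : k2α m α M X₀ = 1)
    {X : Parabolic (EuclideanSpace ℝ (Fin N))} (hX : X ∈ M) (hlt : edist X₀ X < edistCompl X₀ U) :
    k2α m α M X ≤ 2 * edistCompl X₀ U / (edistCompl X₀ U - edist X₀ X) := by
  rw [h1, mul_one] at h0
  exact (k2α_le_div_of_k2αOn_le hs hK hX X₀ hlt).trans (ENNReal.div_le_div_right h0 _)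

end Normalization


/-! ### Tracks of families of maps are proper in their time slab -/

section Track

variable {E : Type*} [NormedAddCommGroup E]

/-- The map `(s, y) ↦ (F s y, s)` into parabolic spacetime is continuous where `F` is jointly
continuous. [cite: White2005, §2.2] -/
theorem continuousOn_trackMap {M : Type*} [TopologicalSpace M] (F : ℝ → M → E) {I : Set ℝ}
    (hF : ContinuousOn (fun p : ℝ × M => F p.1 p.2) (I ×ˢ univ)) :
    ContinuousOn (fun p : ℝ × M => (⟨F p.1 p.2, p.1⟩ : Parabolic E)) (I ×ˢ univ) := by
  have h : (fun p : ℝ × M => (⟨F p.1 p.2, p.1⟩ : Parabolic E)) =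
      (homeomorphProd (E := E)).symm ∘ fun p : ℝ × M => (F p.1 p.2, p.1) := rfl
  rw [h]
  exact (homeomorphProd (E := E)).symm.continuous.comp_continuousOn
    (hF.prodMk continuous_fst.continuousOn)

/-- **The spacetime track of a family over an open time set is proper in its slab** (White 2005,
§2.3: "`𝓜 = closure(𝓜) ∩ U`"): for `F` jointly continuous on `I × M`, `M` compact and `I` open,
`closure 𝓜 ∩ (R^N × I) ⊆ 𝓜` for `𝓜 = {(F s y, s) : s ∈ I, y ∈ M}` (a limit point at an admissible
time lies in the compact image of `[b, c] × M` for a compact time interval `[b, c] ⊆ I` around it).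
[cite: White2005, §2.3] -/
theorem closure_track_inter_subset {M : Type*} [TopologicalSpace M] [CompactSpace M]
    (F : ℝ → M → E) {I : Set ℝ} (hI : IsOpen I)
    (hF : ContinuousOn (fun p : ℝ × M => F p.1 p.2) (I ×ˢ univ)) :
    closure {Y : Parabolic E | ∃ s ∈ I, ∃ y : M, Y = ⟨F s y, s⟩} ∩ {Y | Y.t ∈ I} ⊆
      {Y : Parabolic E | ∃ s ∈ I, ∃ y : M, Y = ⟨F s y, s⟩} := by
  rintro Y ⟨hYcl, hYt⟩
  -- a compact time interval `[b, c] ⊆ I` around `Y.t`, and the open slab over its interior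
  obtain ⟨b, c, hYbc, hbc, hbcI⟩ := exists_Icc_mem_subset_of_mem_nhds (hI.mem_nhds hYt)
  set W : Set (Parabolic E) := {Z | Z.t ∈ interior (Icc b c)} with hW
  have hWopen : IsOpen W := isOpen_interior.preimage continuous_t
  have hYW : Y ∈ W := by
    show Y.t ∈ interior (Icc b c)
    exact mem_interior_iff_mem_nhds.2 hbc
  -- the compact piece of the track over `[b, c]`
  set K : Set (Parabolic E) :=
    (fun p : ℝ × M => (⟨F p.1 p.2, p.1⟩ : Parabolic E)) '' (Icc b c ×ˢ univ)
  have hKc : IsCompact K :=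
    (isCompact_Icc.prod isCompact_univ).image_of_continuousOn
      ((continuousOn_trackMap F hF).mono (prod_mono hbcI Subset.rfl))
  have hsub : {Y : Parabolic E | ∃ s ∈ I, ∃ y : M, Y = ⟨F s y, s⟩} ∩ W ⊆ K := by
    rintro Z ⟨⟨s, hs, y, rfl⟩, hZW⟩
    exact ⟨(s, y), ⟨interior_subset hZW, mem_univ _⟩, rfl⟩
  have hYK : Y ∈ K := by
    have h1 : Y ∈ closure ({Y : Parabolic E | ∃ s ∈ I, ∃ y : M, Y = ⟨F s y, s⟩} ∩ W) := by
      have := hWopen.inter_closure ⟨hYW, hYcl⟩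
      rwa [inter_comm] at this
    exact hKc.isClosed.closure_subset_iff.2 hsub h1
  obtain ⟨⟨s, y⟩, ⟨hs, -⟩, hsy⟩ := hYK
  exact ⟨s, hbcI hs, y, hsy.symm⟩

end Track

end ParabolicFlow

end Literature.Geometry.Riemannian
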